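import Literature.NumberTheory.Sieve.SquarefreeDivisorMoments
import Literature.NumberTheory.Sieve.LargeSieveInequality
import Literature.NumberTheory.Sieve.RamanujanSum
import HarnessLib

/-!
# Green–Tao (2006): the `L^q → L²_β` restriction estimate for a Fourier-structured majorant

B. Green, T. Tao, *Restriction theory of the Selberg sieve, with applications*, JTNB **18** (2006)
[GreenTao2006Restriction], §4, Proposition 4.1 and its proof ((4.2)–(4.6)), after Bourgain
(1989).  This file proves the ABSTRACT form of the key estimate (4.2) ("set version"): it is the
third layer of the proof of the named fact
`Literature.NumberTheory.Sieve.GreenTao2006_envelopingSieve_extension`; everything is PROVED.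

## Statement (`restriction_set_estimate`)

Data: `0 < ε ≤ 1/4`, `A ≥ 1`; integers `N ≥ 16`, `Q ≥ 1` with `Q² ≤ N`; a finite family of
frequencies `θ_i = a_i/q_i` (`1 ≤ q_i ≤ Q` squarefree), pairwise distinct modulo `1`, with
complex weights `|w_i| ≤ A q_i^{ε-1}`; a weight `β₀(n) = ∑_i w_i e(θ_i n) ≥ 0` on `ℤ` and a
second weight `β` with `0 ≤ β ≤ β₀` on `[1, N]` and a moment bound `∑_{n ≤ N} β(n)^s ≤ M N`
(`ε s ≥ 1`, `1 ≤ M`, `M² ≤ N`).  Conclusion: there is `C = C(ε, A)` such that for every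
`B ⊆ ℤ/Nℤ` and every `f` supported on `B` with `|f| ≤ 1`,

  `∑_{n=1}^{N} |∑_b f(b) e(bn/N)|² β(n) ≤ C · N · |B|^{1 + 3ε}`.

This is GT's (4.2) (`𝔼_{1≤n≤N} |f̂(n)|² β_R(n) ≪_ε |B|^{1+ε}`) with the properties of `β_R` that
the proof uses ((3.3) = Fourier expansion with `|w(a/q)| ≪ q^{ε-1}`; a crude size bound)
abstracted into hypotheses.  Deviations from the printed proof, all inessential: the smooth
cutoff `ψ` and Poisson summation are replaced by Fejér kernels (finite geometric sums), whose
`1/‖x‖²` tails are handled by a dyadic decomposition; the "crude estimate `β_R ≪ R^{ε²}`" for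
large `|B|` is replaced by the moment bound (case `|B| ≥ M`); the restricted divisor moment is the
tree's `Literature.NumberTheory.Sieve.sum_pow_card_sqfreeDivisors_le`.

## References

* [GreenTao2006Restriction] Green–Tao, JTNB 18 (2006), §4, Prop. 4.1, (4.2)–(4.6)
  (arXiv:math/0405581).
* J. Bourgain, *On Λ(p)-subsets of squares*, Israel J. Math. 67 (1989) 291–311.
-/

noncomputable section

open Finset Real Complex
open scoped FourierTransform ComplexConjugate

namespace Literature.NumberTheory.Sieve

namespace GreenTao2006

open LargeSieve (e e_add e_int norm_e conj_e e_zero e_eq_exp e_sub e_nat_mul e_add_int norm_e_sub_one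
  abs_sin_pi_mul_eq_fract two_mul_le_sin_pi_mul norm_geom_sum_le card_mul_le_max_of_separated)

/-! ### Parseval on `ℤ/Nℤ` over a window of `N` consecutive integers -/

/-- `e(-t) = conj e(t)` written with a product: `e(s) conj(e(t)) = e(s - t)`. [folklore] -/
theorem e_mul_conj_e (s t : ℝ) : e s * conj (e t) = e (s - t) := (e_sub s t).symm

/-- **Parseval over a window**: for `f : ℤ/Nℤ → ℂ` and any `a ∈ ℤ`,
`∑_{j<N} |∑_{b<N} f(b) e(b(a+j)/N)|² = N ∑_{b<N} |f(b)|²`. [folklore] -/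
theorem sum_window_norm_sq_dft {N : ℕ} (hN : 0 < N) (f : ℕ → ℂ) (a : ℤ) :
    ∑ j ∈ range N, ‖∑ b ∈ range N, f b * e ((b : ℝ) * ((a + j : ℤ) : ℝ) / N)‖ ^ 2 =
      N * ∑ b ∈ range N, ‖f b‖ ^ 2 := by
  have key : ∀ b ∈ range N, ∀ b' ∈ range N,
      ∑ j ∈ range N, f b * e ((b : ℝ) * ((a + j : ℤ) : ℝ) / N) *
        (conj (f b') * conj (e ((b' : ℝ) * ((a + j : ℤ) : ℝ) / N))) =
      if b = b' then (N : ℂ) * (f b * conj (f b)) else 0 := by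
    intro b hb b' hb'
    rw [Finset.mem_range] at hb hb'
    have h1 : ∀ j : ℕ, f b * e ((b : ℝ) * ((a + j : ℤ) : ℝ) / N) *
        (conj (f b') * conj (e ((b' : ℝ) * ((a + j : ℤ) : ℝ) / N))) =
        f b * conj (f b') * e (((b : ℝ) - b') * a / N) *
          e ((j : ℝ) * (((b : ℤ) - b' : ℤ) : ℝ) / N) := by
      intro j
      rw [mul_mul_mul_comm, e_mul_conj_e, mul_assoc (f b * conj (f b')), ← e_add]
      congr 2; push_cast; ring
    simp_rw [h1]
    rw [← Finset.mul_sum, RamanujanSum.sum_range_fourierChar_div hN.ne']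
    by_cases hbb : b = b'
    · subst hbb
      rw [if_pos (by simp), if_pos rfl, show ((b : ℝ) - b) * a / N = 0 by ring, e_zero]; ring
    · rw [if_neg, if_neg hbb, mul_zero]
      rintro ⟨c, hc⟩
      have hc0 : c ≠ 0 := by
        rintro rfl
        rw [mul_zero, sub_eq_zero] at hc
        exact hbb (by exact_mod_cast hc)
      have h1c : (1 : ℤ) ≤ |c| := Int.one_le_abs hc0
      have h2 : |(b : ℤ) - b'| < N := by rw [abs_lt]; omega
      rw [hc, abs_mul, Nat.abs_cast] at h2
      have hN' : (0 : ℤ) < N := by exact_mod_cast hN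
      nlinarith
  apply Complex.ofReal_injective
  simp only [Complex.ofReal_sum, Complex.ofReal_mul, Complex.ofReal_pow, Complex.ofReal_natCast]
  simp_rw [← Complex.mul_conj', map_sum, Finset.sum_mul_sum, map_mul]
  rw [Finset.sum_comm]
  calc ∑ b ∈ range N, ∑ j ∈ range N, ∑ b' ∈ range N,
        f b * e ((b : ℝ) * ((a + j : ℤ) : ℝ) / N) *
          (conj (f b') * conj (e ((b' : ℝ) * ((a + j : ℤ) : ℝ) / N)))
      = ∑ b ∈ range N, ∑ b' ∈ range N, ∑ j ∈ range N,
          f b * e ((b : ℝ) * ((a + j : ℤ) : ℝ) / N) *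
            (conj (f b') * conj (e ((b' : ℝ) * ((a + j : ℤ) : ℝ) / N))) :=
        Finset.sum_congr rfl fun b _ => Finset.sum_comm
    _ = ∑ b ∈ range N, ∑ b' ∈ range N,
          (if b = b' then (N : ℂ) * (f b * conj (f b)) else 0) :=
        Finset.sum_congr rfl fun b hb => Finset.sum_congr rfl fun b' hb' => key b hb b' hb'
    _ = (N : ℂ) * ∑ b ∈ range N, f b * conj (f b) := by
        rw [Finset.mul_sum]
        refine Finset.sum_congr rfl fun b hb => ?_
        rw [Finset.sum_ite_eq, if_pos hb]

/-- The window version with `f` supported on `B ⊆ [0, N)`: for `|f| ≤ 1`,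
`∑_{j<N} |∑_{b ∈ B} f(b) e(b(a+j)/N)|² ≤ N |B|`. [folklore] -/
theorem sum_window_norm_sq_le {N : ℕ} (hN : 0 < N) {B : Finset ℕ} (hB : B ⊆ range N)
    {f : ℕ → ℂ} (hf : ∀ b, ‖f b‖ ≤ 1) (a : ℤ) :
    ∑ j ∈ range N, ‖∑ b ∈ B, f b * e ((b : ℝ) * ((a + j : ℤ) : ℝ) / N)‖ ^ 2 ≤ N * B.card := by
  classical
  -- extend `f 1_B` to `range N`
  set g : ℕ → ℂ := fun b => if b ∈ B then f b else 0 with hg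
  have hsum : ∀ j : ℕ, ∑ b ∈ B, f b * e ((b : ℝ) * ((a + j : ℤ) : ℝ) / N) =
      ∑ b ∈ range N, g b * e ((b : ℝ) * ((a + j : ℤ) : ℝ) / N) := by
    intro j
    rw [← Finset.sum_subset hB (f := fun b => g b * e ((b : ℝ) * ((a + j : ℤ) : ℝ) / N))]
    · exact Finset.sum_congr rfl fun b hb => by rw [hg]; simp [hb]
    · intro b _ hb; rw [hg]; simp [hb]
  simp_rw [hsum]
  rw [sum_window_norm_sq_dft hN g a]
  gcongr
  calc ∑ b ∈ range N, ‖g b‖ ^ 2 = ∑ b ∈ B, ‖g b‖ ^ 2 := by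
        refine (Finset.sum_subset hB fun b _ hb => ?_).symm
        rw [hg]; simp [hb]
    _ ≤ ∑ b ∈ B, (1 : ℝ) := Finset.sum_le_sum fun b hb => by
        rw [hg]; simp only [hb, if_true]
        have := hf b
        nlinarith [norm_nonneg (f b)]
    _ = B.card := by simp

/-- Trivial bound: `|∑_{b ∈ B} f(b) e(·)| ≤ |B|` for `|f| ≤ 1`. [folklore] -/
theorem norm_sum_mul_e_le_card {B : Finset ℕ} {f : ℕ → ℂ} (hf : ∀ b, ‖f b‖ ≤ 1) (t : ℕ → ℝ) :
    ‖∑ b ∈ B, f b * e (t b)‖ ≤ B.card := by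
  calc ‖∑ b ∈ B, f b * e (t b)‖ ≤ ∑ b ∈ B, ‖f b * e (t b)‖ := norm_sum_le _ _
    _ ≤ ∑ b ∈ B, (1 : ℝ) := Finset.sum_le_sum fun b _ => by rw [norm_mul, norm_e, mul_one]; exact hf b
    _ = B.card := by simp

/-! ### Geometric sums: the Fejér-type bounds -/

/-- `|∑_{j<L} e(jy)| ≤ L`. [folklore] -/
theorem norm_sum_range_e_le (L : ℕ) (y : ℝ) : ‖∑ j ∈ range L, e (j * y)‖ ≤ L := by
  calc ‖∑ j ∈ range L, e (j * y)‖ ≤ ∑ j ∈ range L, ‖e (j * y)‖ := norm_sum_le _ _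
    _ = L := by simp

/-- `2 · dist(y, ℤ) ≤ |sin(π y)|`: if every integer is at distance `> r` from `y` then
`|sin(πy)| ≥ 2r`. [folklore] -/
theorem two_mul_le_abs_sin_of_forall {r y : ℝ} (hy : ∀ m : ℤ, r < |y - m|) :
    2 * r ≤ |Real.sin (π * y)| := by
  rw [abs_sin_pi_mul_eq_fract]
  have hu0 : 0 ≤ Int.fract y := Int.fract_nonneg y
  have hu1 : Int.fract y < 1 := Int.fract_lt_one y
  rcases le_or_gt (Int.fract y) (1 / 2) with hu | hu
  · have h1 : r < Int.fract y := by
      have := hy ⌊y⌋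
      rwa [← Int.fract, abs_of_nonneg hu0] at this
    have h2 := two_mul_le_sin_pi_mul hu0 hu
    rw [abs_of_nonneg (by linarith)]
    linarith
  · have h1 : r < 1 - Int.fract y := by
      have := hy (⌊y⌋ + 1)
      rw [show y - ((⌊y⌋ + 1 : ℤ) : ℝ) = Int.fract y - 1 by rw [Int.fract]; push_cast; ring,
        abs_sub_comm, abs_of_nonneg (by linarith)] at this
      exact this
    have h2 := two_mul_le_sin_pi_mul (u := 1 - Int.fract y) (by linarith) (by linarith)
    rw [show π * (1 - Int.fract y) = π - π * Int.fract y by ring, Real.sin_pi_sub] at h2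
    rw [abs_of_nonneg (by linarith)]
    linarith

/-- If every integer is at distance `> r > 0` from `y`, then `|∑_{j<L} e(jy)| ≤ 1/(2r)`.
[folklore] -/
theorem norm_sum_range_e_le_inv {r y : ℝ} (hr : 0 < r) (hy : ∀ m : ℤ, r < |y - m|) (L : ℕ) :
    ‖∑ j ∈ range L, e (j * y)‖ ≤ 1 / (2 * r) := by
  have hsin := two_mul_le_abs_sin_of_forall hy
  have hsin0 : 0 < |Real.sin (π * y)| := lt_of_lt_of_le (by linarith) hsin
  have hne : e y ≠ 1 := by
    intro h
    have : ‖e y - 1‖ = 0 := by rw [h, sub_self, norm_zero]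
    rw [norm_e_sub_one] at this
    linarith
  have h1 : ∑ j ∈ range L, e (j * y) = ∑ j ∈ range L, (e y) ^ j :=
    Finset.sum_congr rfl fun j _ => e_nat_mul j y
  rw [h1]
  calc ‖∑ j ∈ range L, e y ^ j‖ ≤ 2 / ‖e y - 1‖ := norm_geom_sum_le (norm_e y) hne L
    _ = 1 / |Real.sin (π * y)| := by rw [norm_e_sub_one]; field_simp
    _ ≤ 1 / (2 * r) := one_div_le_one_div_of_le (by linarith) hsin

open Classical in
/-- **Dyadic majorant for the Fejér kernel**: for `N ≥ 1` and every real `y`,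
`|∑_{j<2N} e(jy)|² ≤ 4N² ∑_{0 ≤ j ≤ N} 4^{-j} · 1[∃ m ∈ ℤ, |y - m| ≤ 2^j/N]`.
[folklore] -/
theorem norm_sq_sum_e_le_dyadic {N : ℕ} (hN : 0 < N) (y : ℝ) :
    ‖∑ j ∈ range (2 * N), e (j * y)‖ ^ 2 ≤
      4 * (N : ℝ) ^ 2 * ∑ j ∈ range (N + 1),
        (4 : ℝ)⁻¹ ^ j * (if ∃ m : ℤ, |y - m| ≤ 2 ^ j / N then 1 else 0) := by
  classical
  have hN0 : (0 : ℝ) < N := by exact_mod_cast hN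
  set P : ℕ → Prop := fun j => ∃ m : ℤ, |y - m| ≤ 2 ^ j / N with hP
  set J := (range (N + 1)).filter P with hJ
  have hNJ : N ∈ J := by
    rw [hJ, Finset.mem_filter, Finset.mem_range]
    refine ⟨Nat.lt_succ_self N, round y, (abs_sub_round y).trans ?_⟩
    rw [le_div_iff₀ hN0]
    have : (N : ℝ) < 2 ^ N := by exact_mod_cast Nat.lt_two_pow_self
    linarith
  have hJne : J.Nonempty := ⟨N, hNJ⟩
  set j₀ := J.min' hJne with hj₀
  have hj₀J : j₀ ∈ J := Finset.min'_mem J hJne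
  have hj₀P : P j₀ := (Finset.mem_filter.1 hj₀J).2
  have hj₀N : j₀ ∈ range (N + 1) := (Finset.mem_filter.1 hj₀J).1
  -- the key bound `‖D‖² ≤ 4 N² 4^{-j₀}`
  have hkey : ‖∑ j ∈ range (2 * N), e (j * y)‖ ^ 2 ≤ 4 * (N : ℝ) ^ 2 * (4 : ℝ)⁻¹ ^ j₀ := by
    rcases Nat.eq_zero_or_pos j₀ with h0 | hpos
    · rw [h0, pow_zero, mul_one]
      have := norm_sum_range_e_le (2 * N) y
      push_cast at this
      nlinarith [norm_nonneg (∑ j ∈ range (2 * N), e (j * y))]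
    · -- `¬ P (j₀ - 1)`
      obtain ⟨k, hk⟩ : ∃ k, j₀ = k + 1 := Nat.exists_eq_succ_of_ne_zero hpos.ne'
      have hnot : ¬ P k := by
        intro hPk
        have hkJ : k ∈ J := by
          rw [hJ, Finset.mem_filter, Finset.mem_range]
          exact ⟨by rw [Finset.mem_range] at hj₀N; omega, hPk⟩
        have := Finset.min'_le J k hkJ
        rw [← hj₀] at this
        omega
      have hfar : ∀ m : ℤ, (2 : ℝ) ^ k / N < |y - m| := by
        intro m
        by_contra hle
        exact hnot ⟨m, not_lt.1 hle⟩
      have hr : (0 : ℝ) < 2 ^ k / N := by positivity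
      have h1 := norm_sum_range_e_le_inv hr hfar (2 * N)
      have h1' : ‖∑ j ∈ range (2 * N), e (j * y)‖ ≤ N / 2 ^ (k + 1) := by
        refine h1.trans (le_of_eq ?_)
        rw [pow_succ]
        field_simp
      have h2 : ‖∑ j ∈ range (2 * N), e (j * y)‖ ^ 2 ≤ ((N : ℝ) / 2 ^ (k + 1)) ^ 2 :=
        pow_le_pow_left₀ (norm_nonneg _) h1' 2
      refine h2.trans ?_
      have h3 : ((N : ℝ) / 2 ^ (k + 1)) ^ 2 = (N : ℝ) ^ 2 * (4 : ℝ)⁻¹ ^ (k + 1) := by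
        rw [div_pow, ← pow_mul, show (2 : ℝ) ^ ((k + 1) * 2) = 4 ^ (k + 1) by
          rw [mul_comm, pow_mul]; norm_num, div_eq_mul_inv, ← inv_pow]
      rw [h3, hk]
      have h4 : 0 ≤ (N : ℝ) ^ 2 * (4 : ℝ)⁻¹ ^ (k + 1) := by positivity
      linarith
  refine hkey.trans ?_
  refine mul_le_mul_of_nonneg_left ?_ (by positivity)
  calc (4 : ℝ)⁻¹ ^ j₀ = (4 : ℝ)⁻¹ ^ j₀ * (if P j₀ then 1 else 0) := by rw [if_pos hj₀P, mul_one]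
    _ ≤ ∑ j ∈ range (N + 1), (4 : ℝ)⁻¹ ^ j * (if P j then 1 else 0) :=
        Finset.single_le_sum (f := fun j => (4 : ℝ)⁻¹ ^ j * (if P j then 1 else 0))
          (fun j _ => by positivity) hj₀N


/-! ### Well-separated frequencies: Farey separation and a packing bound -/

/-- **Farey separation**: distinct (mod `1`) fractions `a/q`, `a'/q'` with `q, q' ≤ Q` satisfy
`|a/q - a'/q' - m| ≥ 1/Q²` for every integer `m`. [cite: GreenTao2006Restriction, §4 (display after (4.4))] -/
theorem farey_separation {θ θ' : ℝ} {q q' Q : ℕ} (hq : 1 ≤ q) (hqQ : q ≤ Q) (hq' : 1 ≤ q')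
    (hq'Q : q' ≤ Q) (hθ : ∃ a : ℤ, θ = a / q) (hθ' : ∃ a : ℤ, θ' = a / q')
    (hne : ∀ m : ℤ, θ - θ' ≠ m) (m : ℤ) : ((Q : ℝ) ^ 2)⁻¹ ≤ |θ - θ' - m| := by
  obtain ⟨a, rfl⟩ := hθ
  obtain ⟨a', rfl⟩ := hθ'
  have hq0 : (0 : ℝ) < q := by exact_mod_cast hq
  have hq0' : (0 : ℝ) < q' := by exact_mod_cast hq'
  have hk : (a : ℝ) / q - a' / q' - m = ((a * q' - a' * q - m * q * q' : ℤ) : ℝ) / (q * q') := by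
    push_cast; field_simp
  have hk0 : (a * q' - a' * q - m * q * q' : ℤ) ≠ 0 := by
    intro h0
    refine hne m ?_
    have : (a : ℝ) / q - a' / q' - m = 0 := by rw [hk, h0]; simp
    linarith
  have h1 : (1 : ℝ) ≤ |((a * q' - a' * q - m * q * q' : ℤ) : ℝ)| := by
    rw [← Int.cast_abs]; exact_mod_cast Int.one_le_abs hk0
  rw [hk, abs_div, abs_of_pos (by positivity : (0 : ℝ) < q * q')]
  rw [le_div_iff₀ (by positivity)]
  have hqq : (q : ℝ) * q' ≤ (Q : ℝ) ^ 2 := by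
    have h1 : (q : ℝ) ≤ Q := by exact_mod_cast hqQ
    have h2 : (q' : ℝ) ≤ Q := by exact_mod_cast hq'Q
    rw [sq]; exact mul_le_mul h1 h2 hq0'.le (Nat.cast_nonneg Q)
  have hQ0 : (0 : ℝ) < (Q : ℝ) ^ 2 := lt_of_lt_of_le (by positivity) hqq
  calc ((Q : ℝ) ^ 2)⁻¹ * (q * q') ≤ ((Q : ℝ) ^ 2)⁻¹ * (Q : ℝ) ^ 2 := by gcongr
    _ = 1 := inv_mul_cancel₀ hQ0.ne'
    _ ≤ _ := h1

open Classical in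
/-- **Packing bound**: if the points `θ_i` are `δ`-separated modulo `1`, then for every `x` and
`r ≥ 0` at most `2r/δ + 1` of them lie within `r` of `-x` modulo `1`.
[cite: GreenTao2006Restriction, §4 ("for each fixed `b, b'` there is at most one fraction")] -/
theorem card_filter_near_le {ι : Type*} (T : Finset ι) (θ : ι → ℝ) {δ : ℝ} (hδ : 0 < δ)
    (hsep : ∀ i ∈ T, ∀ i' ∈ T, i ≠ i' → ∀ m : ℤ, δ ≤ |θ i - θ i' - m|) (x : ℝ) {r : ℝ}
    (hr : 0 ≤ r) :
    ((T.filter (fun i => ∃ m : ℤ, |x + θ i - m| ≤ r)).card : ℝ) ≤ 2 * r / δ + 1 := by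
  classical
  set I := T.filter (fun i => ∃ m : ℤ, |x + θ i - m| ≤ r) with hI
  rcases I.eq_empty_or_nonempty with hIe | hIne
  · rw [hIe, Finset.card_empty, Nat.cast_zero]; positivity
  have hmem : ∀ i ∈ I, ∃ m : ℤ, |x + θ i - m| ≤ r := fun i hi => (Finset.mem_filter.1 hi).2
  choose! mc hmc using hmem
  set g : ι → ℝ := fun i => x + θ i - mc i + r + δ with hg
  have hgsep : ∀ i ∈ I, ∀ i' ∈ I, i ≠ i' → δ ≤ |g i - g i'| := by
    intro i hi i' hi' hne
    have := hsep i (Finset.mem_filter.1 hi).1 i' (Finset.mem_filter.1 hi').1 hne (mc i - mc i')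
    rw [hg]
    convert this using 2
    push_cast; ring
  have hinj : Set.InjOn g ↑I := by
    intro i hi i' hi' h
    by_contra hne
    have := hgsep i hi i' hi' hne
    rw [h, sub_self, abs_zero] at this
    linarith
  have hcard : (I.image g).card = I.card := Finset.card_image_of_injOn hinj
  have hne' : (I.image g).Nonempty := hIne.image g
  have h1 : ∀ t ∈ I.image g, δ ≤ t := by
    intro t ht
    obtain ⟨i, hi, rfl⟩ := Finset.mem_image.1 ht
    have := hmc i hi
    rw [abs_le] at this
    rw [hg]; simp only; linarith
  have h2 : ∀ t ∈ I.image g, ∀ t' ∈ I.image g, t ≠ t' → δ ≤ |t - t'| := by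
    intro t ht t' ht' htt
    obtain ⟨i, hi, rfl⟩ := Finset.mem_image.1 ht
    obtain ⟨i', hi', rfl⟩ := Finset.mem_image.1 ht'
    exact hgsep i hi i' hi' (fun h => htt (by rw [h]))
  have h3 := card_mul_le_max_of_separated (I.image g) h1 h2 hne'
  have h4 : (I.image g).max' hne' ≤ 2 * r + δ := by
    refine Finset.max'_le _ _ _ fun t ht => ?_
    obtain ⟨i, hi, rfl⟩ := Finset.mem_image.1 ht
    have := hmc i hi
    rw [abs_le] at this
    rw [hg]; simp only; linarith
  rw [hcard] at h3
  rw [div_add_one hδ.ne', le_div_iff₀ hδ]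
  linarith

/-! ### Averaging `[1, N]` into a Fejér double sum -/

/-- For `G ≥ 0` on `ℤ`: `N ∑_{n=1}^{N} G(n) ≤ ∑_{j₁, j₂ < 2N} G(N + j₁ - j₂)` (each `n ∈ [1, N]`
arises from at least `N` pairs). [folklore] -/
theorem mul_sum_Icc_le_sum_sum {N : ℕ} (G : ℤ → ℝ) (hG : ∀ m, 0 ≤ G m) :
    (N : ℝ) * ∑ n ∈ Icc 1 N, G n ≤
      ∑ j₁ ∈ range (2 * N), ∑ j₂ ∈ range (2 * N), G ((N : ℤ) + j₁ - j₂) := by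
  classical
  rw [← Finset.sum_product']
  set P := range (2 * N) ×ˢ range (2 * N) with hP
  set v : ℕ × ℕ → ℤ := fun x => (N : ℤ) + x.1 - x.2 with hv
  set P' := P.filter (fun x => 1 ≤ v x ∧ v x ≤ N) with hP'
  have h1 : ∑ x ∈ P', G (v x) ≤ ∑ x ∈ P, G (v x) :=
    Finset.sum_le_sum_of_subset_of_nonneg (Finset.filter_subset _ _) fun x _ _ => hG _
  refine le_trans ?_ h1
  have hmaps : ∀ x ∈ P', (v x).toNat ∈ Icc 1 N := by
    intro x hx
    have hx' := (Finset.mem_filter.1 hx).2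
    rw [Finset.mem_Icc]
    constructor <;> omega
  rw [← Finset.sum_fiberwise_of_maps_to hmaps, Finset.mul_sum]
  refine Finset.sum_le_sum fun n hn => ?_
  rw [Finset.mem_Icc] at hn
  have hfib : ∀ x ∈ P'.filter (fun x => (v x).toNat = n), G (v x) = G n := by
    intro x hx
    rw [Finset.mem_filter] at hx
    have hx1 := (Finset.mem_filter.1 hx.1).2
    congr 1
    rw [← hx.2, Int.toNat_of_nonneg (by omega)]
  rw [Finset.sum_congr rfl hfib, Finset.sum_const, nsmul_eq_mul]
  refine mul_le_mul_of_nonneg_right ?_ (hG n)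
  -- at least `N` pairs in the fibre: `j₁ ↦ (j₁, j₁ + N - n)`
  have hinj : Set.InjOn (fun j₁ : ℕ => (j₁, j₁ + N - n)) ↑(range N) := by
    intro j hj j' hj' h
    simp only [Prod.mk.injEq] at h
    exact h.1
  have hmaps' : Set.MapsTo (fun j₁ : ℕ => (j₁, j₁ + N - n)) ↑(range N)
      ↑(P'.filter (fun x => (v x).toNat = n)) := by
    intro j hj
    rw [Finset.coe_range, Set.mem_Iio] at hj
    rw [Finset.mem_coe, Finset.mem_filter, hP', Finset.mem_filter, hP, Finset.mem_product,
      Finset.mem_range, Finset.mem_range, hv]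
    simp only
    refine ⟨⟨⟨by omega, by omega⟩, ?_, ?_⟩, ?_⟩ <;> omega
  have := Finset.card_le_card_of_injOn _ hmaps' hinj
  rw [Finset.card_range] at this
  exact_mod_cast this


/-! ### Expanding `|f̂(m)|² β₀(m)` and the Fejér double sum -/

/-- Pointwise expansion: `|f̂(m)|² β₀(m) = ∑_{b, b' ∈ B} ∑_i f(b) conj f(b') w_i e(m y_{b,b',i})`
with `y_{b,b',i} = (b - b')/N + θ_i`, for `f` supported on `B` and
`β₀(m) = ∑_i w_i e(θ_i m)`. [cite: GreenTao2006Restriction, §4 (expansion before (4.4))] -/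
theorem normSq_dft_mul_eq_sum {N : ℕ} {B : Finset ℕ} (hB : B ⊆ range N) {f : ℕ → ℂ}
    (hfB : ∀ b ∉ B, f b = 0) {ι : Type*} (T : Finset ι) (θ : ι → ℝ) (w : ι → ℂ) (β₀ : ℤ → ℝ)
    (hβ₀ : ∀ m : ℤ, (β₀ m : ℂ) = ∑ i ∈ T, w i * e (θ i * m)) (m : ℤ) :
    (((‖∑ b ∈ range N, f b * e ((b : ℝ) * m / N)‖ ^ 2 * β₀ m : ℝ)) : ℂ) =
      ∑ t ∈ B ×ˢ (B ×ˢ T), f t.1 * conj (f t.2.1) * w t.2.2 *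
        e ((m : ℝ) * (((t.1 : ℝ) - t.2.1) / N + θ t.2.2)) := by
  have hF : ∑ b ∈ range N, f b * e ((b : ℝ) * m / N) = ∑ b ∈ B, f b * e ((b : ℝ) * m / N) :=
    (Finset.sum_subset hB fun b _ hb => by rw [hfB b hb, zero_mul]).symm
  push_cast
  rw [← Complex.mul_conj', hF, hβ₀ m, map_sum]
  simp_rw [map_mul, conj_e]
  rw [Finset.sum_mul_sum, Finset.sum_mul, Finset.sum_product]
  refine Finset.sum_congr rfl fun b _ => ?_
  rw [Finset.sum_mul, Finset.sum_product]
  refine Finset.sum_congr rfl fun b' _ => ?_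
  rw [Finset.mul_sum]
  refine Finset.sum_congr rfl fun i _ => ?_
  simp only
  rw [show f b * e ((b : ℝ) * m / N) * (conj (f b') * e (-((b' : ℝ) * m / N))) * (w i * e (θ i * m)) =
    f b * conj (f b') * w i * (e ((b : ℝ) * m / N) * e (-((b' : ℝ) * m / N)) * e (θ i * m)) by ring,
    ← e_add, ← e_add]
  congr 2
  ring

/-- `∑_{j₁,j₂<L} e((N + j₁ - j₂) y) = e(Ny) · D(y) · conj D(y)`, `D(y) = ∑_{j<L} e(jy)`. [folklore] -/
theorem sum_sum_e_shift (N L : ℕ) (y : ℝ) :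
    ∑ j₁ ∈ range L, ∑ j₂ ∈ range L, e ((((N : ℤ) + j₁ - j₂ : ℤ) : ℝ) * y) =
      e (N * y) * ((∑ j ∈ range L, e (j * y)) * conj (∑ j ∈ range L, e (j * y))) := by
  rw [map_sum, Finset.sum_mul_sum, Finset.mul_sum]
  refine Finset.sum_congr rfl fun j₁ _ => ?_
  rw [Finset.mul_sum]
  refine Finset.sum_congr rfl fun j₂ _ => ?_
  rw [conj_e, ← e_add, ← e_add]
  congr 1; push_cast; ring

/-- **The Fejér double sum is controlled by the kernel at the phases `y_{b,b',i}`**: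
`∑_{j₁,j₂<2N} |f̂(N+j₁-j₂)|² β₀(N+j₁-j₂) ≤ ∑_{b,b'∈B} ∑_i |w_i| |D(y_{b,b',i})|²`
(`|f| ≤ 1` supported on `B`). [cite: GreenTao2006Restriction, §4 (reduction to (4.4))] -/
theorem fejer_double_sum_le {N : ℕ} {B : Finset ℕ} (hB : B ⊆ range N) {f : ℕ → ℂ}
    (hf : ∀ b, ‖f b‖ ≤ 1) (hfB : ∀ b ∉ B, f b = 0) {ι : Type*} (T : Finset ι) (θ : ι → ℝ)
    (w : ι → ℂ) (β₀ : ℤ → ℝ) (hβ₀ : ∀ m : ℤ, (β₀ m : ℂ) = ∑ i ∈ T, w i * e (θ i * m))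
    (hβ₀nn : ∀ m, 0 ≤ β₀ m) :
    ∑ j₁ ∈ range (2 * N), ∑ j₂ ∈ range (2 * N),
        ‖∑ b ∈ range N, f b * e ((b : ℝ) * (((N : ℤ) + j₁ - j₂ : ℤ) : ℝ) / N)‖ ^ 2 *
          β₀ ((N : ℤ) + j₁ - j₂) ≤
      ∑ b ∈ B, ∑ b' ∈ B, ∑ i ∈ T, ‖w i‖ *
        ‖∑ j ∈ range (2 * N), e (j * (((b : ℝ) - b') / N + θ i))‖ ^ 2 := by
  suffices hprod : ∑ j₁ ∈ range (2 * N), ∑ j₂ ∈ range (2 * N),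
        ‖∑ b ∈ range N, f b * e ((b : ℝ) * (((N : ℤ) + j₁ - j₂ : ℤ) : ℝ) / N)‖ ^ 2 *
          β₀ ((N : ℤ) + j₁ - j₂) ≤
      ∑ t ∈ B ×ˢ (B ×ˢ T), ‖w t.2.2‖ *
        ‖∑ j ∈ range (2 * N), e (j * (((t.1 : ℝ) - t.2.1) / N + θ t.2.2))‖ ^ 2 by
    refine hprod.trans (le_of_eq ?_)
    rw [Finset.sum_product]
    refine Finset.sum_congr rfl fun b _ => ?_
    rw [Finset.sum_product]
  set L := 2 * N with hL
  set y : ℕ × (ℕ × ι) → ℝ := fun t => ((t.1 : ℝ) - t.2.1) / N + θ t.2.2 with hy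
  set c : ℕ × (ℕ × ι) → ℂ := fun t => f t.1 * conj (f t.2.1) * w t.2.2 with hc
  -- the left side, as a complex number
  have hZ : ((∑ j₁ ∈ range L, ∑ j₂ ∈ range L,
      ‖∑ b ∈ range N, f b * e ((b : ℝ) * (((N : ℤ) + j₁ - j₂ : ℤ) : ℝ) / N)‖ ^ 2 *
        β₀ ((N : ℤ) + j₁ - j₂) : ℝ) : ℂ) =
      ∑ t ∈ B ×ˢ (B ×ˢ T), c t * (e (N * y t) *
        ((∑ j ∈ range L, e (j * y t)) * conj (∑ j ∈ range L, e (j * y t)))) := by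
    simp only [Complex.ofReal_sum, Complex.ofReal_mul, Complex.ofReal_pow]
    have h1 : ∀ j₁ j₂ : ℕ,
        ((‖∑ b ∈ range N, f b * e ((b : ℝ) * (((N : ℤ) + j₁ - j₂ : ℤ) : ℝ) / N)‖ : ℂ) ^ 2 *
          (β₀ ((N : ℤ) + j₁ - j₂) : ℂ)) =
        ∑ t ∈ B ×ˢ (B ×ˢ T), c t * e ((((N : ℤ) + j₁ - j₂ : ℤ) : ℝ) * y t) := by
      intro j₁ j₂
      have := normSq_dft_mul_eq_sum hB hfB T θ w β₀ hβ₀ ((N : ℤ) + j₁ - j₂)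
      rw [Complex.ofReal_mul, Complex.ofReal_pow] at this
      rw [this]
    simp_rw [h1]
    calc ∑ j₁ ∈ range L, ∑ j₂ ∈ range L, ∑ t ∈ B ×ˢ (B ×ˢ T),
          c t * e ((((N : ℤ) + j₁ - j₂ : ℤ) : ℝ) * y t)
        = ∑ j₁ ∈ range L, ∑ t ∈ B ×ˢ (B ×ˢ T), ∑ j₂ ∈ range L,
            c t * e ((((N : ℤ) + j₁ - j₂ : ℤ) : ℝ) * y t) :=
          Finset.sum_congr rfl fun _ _ => Finset.sum_comm
      _ = ∑ t ∈ B ×ˢ (B ×ˢ T), ∑ j₁ ∈ range L, ∑ j₂ ∈ range L,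
            c t * e ((((N : ℤ) + j₁ - j₂ : ℤ) : ℝ) * y t) := Finset.sum_comm
      _ = _ := by
          refine Finset.sum_congr rfl fun t _ => ?_
          rw [← sum_sum_e_shift, Finset.mul_sum]
          simp_rw [Finset.mul_sum]
  -- take norms
  have hreal : ∑ j₁ ∈ range L, ∑ j₂ ∈ range L,
      ‖∑ b ∈ range N, f b * e ((b : ℝ) * (((N : ℤ) + j₁ - j₂ : ℤ) : ℝ) / N)‖ ^ 2 *
        β₀ ((N : ℤ) + j₁ - j₂) =
      ‖((∑ j₁ ∈ range L, ∑ j₂ ∈ range L,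
        ‖∑ b ∈ range N, f b * e ((b : ℝ) * (((N : ℤ) + j₁ - j₂ : ℤ) : ℝ) / N)‖ ^ 2 *
          β₀ ((N : ℤ) + j₁ - j₂) : ℝ) : ℂ)‖ := by
    rw [Complex.norm_real, Real.norm_eq_abs, abs_of_nonneg]
    exact Finset.sum_nonneg fun j₁ _ => Finset.sum_nonneg fun j₂ _ =>
      mul_nonneg (sq_nonneg _) (hβ₀nn _)
  rw [hreal, hZ]
  refine (norm_sum_le _ _).trans (Finset.sum_le_sum fun t _ => ?_)
  simp only [hc, hy, norm_mul, norm_e, one_mul, Complex.norm_conj]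
  set D := ∑ j ∈ range L, e (j * (((t.1 : ℝ) - t.2.1) / N + θ t.2.2)) with hD
  have h12 : ‖f t.1‖ * ‖f t.2.1‖ ≤ 1 := by
    have := mul_le_mul (hf t.1) (hf t.2.1) (norm_nonneg _) zero_le_one
    linarith
  have hX : 0 ≤ ‖w t.2.2‖ * (‖D‖ * ‖D‖) := by positivity
  calc ‖f t.1‖ * ‖f t.2.1‖ * ‖w t.2.2‖ * (‖D‖ * ‖D‖)
      = (‖f t.1‖ * ‖f t.2.1‖) * (‖w t.2.2‖ * (‖D‖ * ‖D‖)) := by ring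
    _ ≤ 1 * (‖w t.2.2‖ * (‖D‖ * ‖D‖)) := mul_le_mul_of_nonneg_right h12 hX
    _ = ‖w t.2.2‖ * ‖D‖ ^ 2 := by ring


/-! ### Large denominators: Farey separation and packing -/

open Classical in
/-- The contribution of the frequencies with denominator `q_i > κ = |B|` to the count of
`(b, b', i)` with `y_{b,b',i}` within `r` of an integer is at most `A κ^{ε+1} (2 r Q² + 1)`
(`|w_i| ≤ A q_i^{ε-1} ≤ A κ^{ε-1}`, and for fixed `b, b'` at most `2rQ² + 1` of the
`Q⁻²`-separated points `θ_i` qualify). [cite: GreenTao2006Restriction, §4 (large `q` in (4.4))] -/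
theorem sum_large_den_le {ι : Type*} (T : Finset ι) (θ : ι → ℝ) (q : ι → ℕ) (w : ι → ℂ)
    {Q : ℕ} {A ε : ℝ} (hA : 0 ≤ A) (hε1 : ε ≤ 1)
    (hq : ∀ i ∈ T, 1 ≤ q i ∧ q i ≤ Q) (hθ : ∀ i ∈ T, ∃ a : ℤ, θ i = a / q i)
    (hsep : ∀ i ∈ T, ∀ j ∈ T, i ≠ j → ∀ m : ℤ, θ i - θ j ≠ m)
    (hw : ∀ i ∈ T, ‖w i‖ ≤ A * (q i : ℝ) ^ (ε - 1))
    (B : Finset ℕ) (hBne : B.Nonempty) (x : ℕ → ℕ → ℝ) {r : ℝ} (hr : 0 ≤ r) :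
    ∑ b ∈ B, ∑ b' ∈ B, ∑ i ∈ T.filter (fun i => (B.card : ℝ) < q i),
        ‖w i‖ * (if ∃ m : ℤ, |x b b' + θ i - m| ≤ r then (1 : ℝ) else 0) ≤
      A * (B.card : ℝ) ^ (ε + 1) * (2 * r * (Q : ℝ) ^ 2 + 1) := by
  set κ : ℝ := (B.card : ℝ) with hκ
  have hκ1 : 1 ≤ κ := by rw [hκ]; exact_mod_cast Finset.card_pos.2 hBne
  have hκ0 : 0 < κ := by linarith
  set T' := T.filter (fun i => κ < q i) with hT'
  -- `Q ≥ 1` as soon as `T'` is nonempty; handle `T' = ∅` first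
  rcases T'.eq_empty_or_nonempty with hTe | hTne
  · rw [hTe]
    simp only [Finset.sum_empty, Finset.sum_const_zero]
    positivity
  obtain ⟨i₀, hi₀⟩ := hTne
  have hQ1 : (1 : ℝ) ≤ Q := by
    have := (hq i₀ (Finset.mem_filter.1 hi₀).1)
    exact_mod_cast this.1.trans this.2
  have hδ : (0 : ℝ) < ((Q : ℝ) ^ 2)⁻¹ := by positivity
  -- separation of the points of `T'`
  have hsep' : ∀ i ∈ T', ∀ i' ∈ T', i ≠ i' → ∀ m : ℤ, ((Q : ℝ) ^ 2)⁻¹ ≤ |θ i - θ i' - m| := by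
    intro i hi i' hi' hne m
    have hi1 := (Finset.mem_filter.1 hi).1
    have hi'1 := (Finset.mem_filter.1 hi').1
    exact farey_separation (hq i hi1).1 (hq i hi1).2 (hq i' hi'1).1 (hq i' hi'1).2 (hθ i hi1)
      (hθ i' hi'1) (hsep i hi1 i' hi'1 hne) m
  -- the weight bound on `T'`
  have hw' : ∀ i ∈ T', ‖w i‖ ≤ A * κ ^ (ε - 1) := by
    intro i hi
    rw [Finset.mem_filter] at hi
    refine (hw i hi.1).trans (mul_le_mul_of_nonneg_left ?_ hA)
    exact Real.rpow_le_rpow_of_nonpos hκ0 hi.2.le (by linarith)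
  -- sum over `b, b'` of the inner count
  have hinner : ∀ b ∈ B, ∀ b' ∈ B,
      ∑ i ∈ T', ‖w i‖ * (if ∃ m : ℤ, |x b b' + θ i - m| ≤ r then (1 : ℝ) else 0) ≤
        A * κ ^ (ε - 1) * (2 * r * (Q : ℝ) ^ 2 + 1) := by
    intro b _ b' _
    simp_rw [mul_ite, mul_one, mul_zero]
    rw [← Finset.sum_filter]
    calc ∑ i ∈ T'.filter (fun i => ∃ m : ℤ, |x b b' + θ i - m| ≤ r), ‖w i‖
        ≤ ∑ i ∈ T'.filter (fun i => ∃ m : ℤ, |x b b' + θ i - m| ≤ r), A * κ ^ (ε - 1) :=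
          Finset.sum_le_sum fun i hi => hw' i (Finset.mem_filter.1 hi).1
      _ = (T'.filter (fun i => ∃ m : ℤ, |x b b' + θ i - m| ≤ r)).card * (A * κ ^ (ε - 1)) := by
          rw [Finset.sum_const, nsmul_eq_mul]
      _ ≤ (2 * r / ((Q : ℝ) ^ 2)⁻¹ + 1) * (A * κ ^ (ε - 1)) :=
          mul_le_mul_of_nonneg_right (card_filter_near_le T' θ hδ hsep' (x b b') hr)
            (by positivity)
      _ = A * κ ^ (ε - 1) * (2 * r * (Q : ℝ) ^ 2 + 1) := by rw [div_inv_eq_mul]; ring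
  calc ∑ b ∈ B, ∑ b' ∈ B, ∑ i ∈ T',
          ‖w i‖ * (if ∃ m : ℤ, |x b b' + θ i - m| ≤ r then (1 : ℝ) else 0)
      ≤ ∑ b ∈ B, ∑ b' ∈ B, A * κ ^ (ε - 1) * (2 * r * (Q : ℝ) ^ 2 + 1) :=
        Finset.sum_le_sum fun b hb => Finset.sum_le_sum fun b' hb' => hinner b hb b' hb'
    _ = A * κ ^ (ε + 1) * (2 * r * (Q : ℝ) ^ 2 + 1) := by
        rw [Finset.sum_const, Finset.sum_const, smul_smul, nsmul_eq_mul, Nat.cast_mul, ← hκ]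
        rw [show ε + 1 = (ε - 1) + 2 by ring, Real.rpow_add hκ0, Real.rpow_two]
        ring

/-- Covering a window of width `2^j/N` by `2^{j+1} + 1` windows of width `1/N`: if `y` is within
`2^j/N` of an integer then `y - l/N` is within `1/N` of an integer for some integer `|l| ≤ 2^j`.
[folklore] -/
theorem exists_shift_near {N : ℕ} (hN : 0 < N) {y : ℝ} {j : ℕ}
    (h : ∃ m : ℤ, |y - m| ≤ 2 ^ j / N) :
    ∃ l ∈ Finset.Icc (-(2 ^ j : ℤ)) (2 ^ j), ∃ m : ℤ, |y - l / N - m| ≤ 1 / N := by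
  obtain ⟨m, hm⟩ := h
  have hN0 : (0 : ℝ) < N := by exact_mod_cast hN
  set l : ℤ := round ((N : ℝ) * (y - m)) with hl
  have h1 : |(N : ℝ) * (y - m) - l| ≤ 1 / 2 := abs_sub_round _
  have h2 : |(N : ℝ) * (y - m)| ≤ 2 ^ j := by
    rw [abs_mul, abs_of_pos hN0]
    rw [le_div_iff₀ hN0] at hm
    linarith [hm]
  refine ⟨l, ?_, m, ?_⟩
  · have h3 : |(l : ℝ)| ≤ 2 ^ j + 1 / 2 := by
      have := abs_sub_abs_le_abs_sub (l : ℝ) ((N : ℝ) * (y - m))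
      rw [abs_sub_comm] at h1
      linarith
    have h4 : |l| ≤ 2 ^ j := by
      have h5 : (|l| : ℝ) < (2 ^ j : ℤ) + 1 := by push_cast; linarith
      have h6 : |l| < (2 ^ j : ℤ) + 1 := by exact_mod_cast h5
      omega
    rw [Finset.mem_Icc, ← abs_le]
    exact h4
  · rw [show y - (l : ℝ) / N - m = ((N : ℝ) * (y - m) - l) / N by field_simp; ring, abs_div,
      abs_of_pos hN0]
    exact div_le_div_of_nonneg_right (by linarith) hN0.le

open Classical in
/-- Indicator form of `exists_shift_near`. [folklore] -/
theorem indicator_near_le_sum_shift {N : ℕ} (hN : 0 < N) (y : ℝ) (j : ℕ) :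
    (if ∃ m : ℤ, |y - m| ≤ 2 ^ j / N then (1 : ℝ) else 0) ≤
      ∑ l ∈ Finset.Icc (-(2 ^ j : ℤ)) (2 ^ j),
        (if ∃ m : ℤ, |y - l / N - m| ≤ 1 / N then (1 : ℝ) else 0) := by
  split_ifs with h
  · obtain ⟨l, hl, hm⟩ := exists_shift_near hN h
    calc (1 : ℝ) = (if ∃ m : ℤ, |y - l / N - m| ≤ 1 / N then (1 : ℝ) else 0) := by rw [if_pos hm]
      _ ≤ _ := Finset.single_le_sum (f := fun l : ℤ =>
          (if ∃ m : ℤ, |y - l / N - m| ≤ 1 / N then (1 : ℝ) else 0))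
          (fun l _ => by positivity) hl
  · exact Finset.sum_nonneg fun l _ => by positivity

/-! ### Small denominators: the positive kernel, completion and orthogonality -/

/-- **Positive-kernel lower bound**: if `z` is within `1/N` of an integer and `8M ≤ N`, then
`|∑_{m<M} e(mz)| ≥ M/2` (all the phases `2π m (z - m₀)` are `≤ π/4` in size). [folklore] -/
theorem half_le_norm_sum_e {N M : ℕ} (hN : 0 < N) (hM : 8 * M ≤ N) {z : ℝ}
    (hz : ∃ m : ℤ, |z - m| ≤ 1 / N) : (M : ℝ) / 2 ≤ ‖∑ m ∈ range M, e (m * z)‖ := by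
  obtain ⟨m₀, hm₀⟩ := hz
  have hN0 : (0 : ℝ) < N := by exact_mod_cast hN
  set δ := z - m₀ with hδ
  have h1 : ∀ m : ℕ, e (m * z) = e (m * δ) := by
    intro m
    rw [hδ, mul_sub, show (m : ℝ) * z - m * m₀ = m * z + ((-(m * m₀) : ℤ) : ℝ) by push_cast; ring,
      e_add_int]
  simp_rw [h1]
  refine le_trans ?_ (Complex.re_le_norm _)
  rw [Complex.re_sum]
  have h2 : ∀ m ∈ range M, (1 : ℝ) / 2 ≤ (e (m * δ)).re := by
    intro m hm
    rw [Finset.mem_range] at hm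
    rw [e_eq_exp, Complex.exp_re]
    simp only [Complex.mul_re, Complex.I_re, Complex.ofReal_re, zero_mul, Complex.I_im,
      Complex.ofReal_im, mul_zero, sub_zero, Real.exp_zero, one_mul, Complex.mul_im, zero_add]
    -- `cos (2π m δ) ≥ 1/2` as `|2π m δ| ≤ π/3`
    have hmM : (m : ℝ) ≤ M := by exact_mod_cast hm.le
    have hMN : 8 * (M : ℝ) ≤ N := by exact_mod_cast hM
    have habs : |2 * π * (m * δ)| ≤ π / 3 := by
      rw [abs_mul, abs_of_pos (by positivity : (0 : ℝ) < 2 * π), abs_mul,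
        abs_of_nonneg (Nat.cast_nonneg m)]
      have hmδ : (m : ℝ) * |δ| ≤ M * (1 / N) := mul_le_mul hmM hm₀ (abs_nonneg _) (Nat.cast_nonneg M)
      have : (M : ℝ) * (1 / N) ≤ 1 / 8 := by
        rw [mul_one_div, div_le_iff₀ hN0]; linarith
      nlinarith [Real.pi_pos]
    rw [← Real.cos_abs, ← Real.cos_pi_div_three]
    exact Real.cos_le_cos_of_nonneg_of_le_pi (abs_nonneg _) (by linarith [Real.pi_pos]) habs
  calc (M : ℝ) / 2 = ∑ m ∈ range M, (1 : ℝ) / 2 := by simp; ring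
    _ ≤ ∑ m ∈ range M, (e (m * δ)).re := Finset.sum_le_sum h2

open Classical in
/-- The indicator of "`z` within `1/N` of an integer" is at most `(4/M²) |∑_{m<M} e(mz)|²`
(`8M ≤ N`, `M ≥ 1`). [folklore] -/
theorem indicator_near_le_kernel {N M : ℕ} (hN : 0 < N) (hM : 8 * M ≤ N) (hM1 : 0 < M) (z : ℝ) :
    (if ∃ m : ℤ, |z - m| ≤ 1 / N then (1 : ℝ) else 0) ≤
      4 / (M : ℝ) ^ 2 * ‖∑ m ∈ range M, e (m * z)‖ ^ 2 := by
  split_ifs with h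
  · have h1 := half_le_norm_sum_e hN hM h
    have hM0 : (0 : ℝ) < M := by exact_mod_cast hM1
    rw [div_mul_eq_mul_div, le_div_iff₀ (by positivity)]
    nlinarith
  · positivity

/-- `|∑_{m<M} e(mz)|² = ∑_{m₁,m₂<M} e((m₁ - m₂) z)` (as complex numbers). [folklore] -/
theorem norm_sq_sum_e_eq_sum_sum (M : ℕ) (z : ℝ) :
    ((‖∑ m ∈ range M, e (m * z)‖ ^ 2 : ℝ) : ℂ) =
      ∑ m₁ ∈ range M, ∑ m₂ ∈ range M, e (((m₁ : ℝ) - m₂) * z) := by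
  rw [show ((‖∑ m ∈ range M, e (m * z)‖ ^ 2 : ℝ) : ℂ) =
      (∑ m ∈ range M, e (m * z)) * conj (∑ m ∈ range M, e (m * z)) by
    rw [Complex.mul_conj']; push_cast; ring, map_sum, Finset.sum_mul_sum]
  refine Finset.sum_congr rfl fun m₁ _ => Finset.sum_congr rfl fun m₂ _ => ?_
  rw [e_mul_conj_e]; congr 1; ring

/-- **Completion over a denominator**: if the `θ_i`, `i ∈ S`, are of the form `a_i/d` and pairwise
distinct modulo `1`, then for a nonnegative `1`-periodic `g`, `∑_{i ∈ S} g(θ_i) ≤ ∑_{a<d} g(a/d)`.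
[cite: GreenTao2006Restriction, §4 (passage from `ℤ_q^*` to `ℤ_q` before (4.6))] -/
theorem sum_le_sum_range_of_periodic {ι : Type*} (S : Finset ι) (θ : ι → ℝ) {d : ℕ} (hd : 0 < d)
    (hθ : ∀ i ∈ S, ∃ a : ℤ, θ i = a / d)
    (hsep : ∀ i ∈ S, ∀ j ∈ S, i ≠ j → ∀ m : ℤ, θ i - θ j ≠ m)
    (g : ℝ → ℝ) (hg0 : ∀ z, 0 ≤ g z) (hg : ∀ (z : ℝ) (k : ℤ), g (z + k) = g z) :
    ∑ i ∈ S, g (θ i) ≤ ∑ a ∈ range d, g (a / d) := by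
  classical
  have hd0 : (d : ℝ) ≠ 0 := by exact_mod_cast hd.ne'
  have hdz : (0 : ℤ) < d := by exact_mod_cast hd
  choose! a ha using hθ
  -- reduced numerators
  set ab : ι → ℕ := fun i => (a i % d).toNat with hab
  have hab_lt : ∀ i ∈ S, ab i < d := by
    intro i _
    have h1 : ((a i % d).toNat : ℤ) = a i % d := Int.toNat_of_nonneg (Int.emod_nonneg _ (by omega))
    have h2 : a i % d < d := Int.emod_lt_of_pos _ hdz
    show (a i % (d : ℤ)).toNat < d
    omega
  have hab_eq : ∀ i ∈ S, θ i = (ab i : ℝ) / d + ((a i / d : ℤ) : ℝ) := by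
    intro i hi
    have h1 : ((a i % d).toNat : ℤ) = a i % d := Int.toNat_of_nonneg (Int.emod_nonneg _ (by omega))
    have h2 : (ab i : ℝ) = ((a i % d : ℤ) : ℝ) := by rw [hab]; exact_mod_cast h1
    have h3 : ((a i : ℤ) : ℝ) = ((a i % d : ℤ) : ℝ) + (d : ℝ) * ((a i / d : ℤ) : ℝ) := by
      have := Int.emod_add_mul_ediv (a i) d
      exact_mod_cast this.symm
    rw [ha i hi, h2, h3, add_div, mul_div_cancel_left₀ _ hd0]
  have hinj : Set.InjOn ab ↑S := by
    intro i hi j hj hij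
    by_contra hne
    refine hsep i hi j hj hne (a i / d - a j / d) ?_
    rw [hab_eq i hi, hab_eq j hj, hij]; push_cast; ring
  calc ∑ i ∈ S, g (θ i) = ∑ i ∈ S, g ((ab i : ℝ) / d) := by
        refine Finset.sum_congr rfl fun i hi => ?_
        rw [hab_eq i hi, hg]
    _ = ∑ x ∈ S.image ab, g ((x : ℝ) / d) :=
        (Finset.sum_image (f := fun x : ℕ => g ((x : ℝ) / d)) hinj).symm
    _ ≤ ∑ x ∈ range d, g ((x : ℝ) / d) := by
        refine Finset.sum_le_sum_of_subset_of_nonneg ?_ fun x _ _ => hg0 _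
        intro x hx
        obtain ⟨i, hi, rfl⟩ := Finset.mem_image.1 hx
        exact Finset.mem_range.2 (hab_lt i hi)


/-- `|∑_{m<M} e(mz)|² = ∑_{(m₁,m₂)} e((m₁ - m₂) z)` over the product index set. [folklore] -/
theorem norm_sq_sum_e_eq_sum_prod (M : ℕ) (z : ℝ) :
    ((‖∑ m ∈ range M, e (m * z)‖ ^ 2 : ℝ) : ℂ) =
      ∑ μ ∈ range M ×ˢ range M, e (((μ.1 : ℝ) - μ.2) * z) := by
  rw [norm_sq_sum_e_eq_sum_sum, Finset.sum_product]

/-- **Orthogonality in the numerator**: summing the kernel over all `a mod d` detects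
`d ∣ m₁ - m₂`:
`∑_{a<d} ∑_{b,b'∈B} |∑_{m<M} e(m((b-b'-l)/N + a/d))|² ≤ d ∑_{m₁,m₂<M, d ∣ m₁-m₂} |∑_{b∈B} e(b(m₁-m₂)/N)|²`.
[cite: GreenTao2006Restriction, §4 ("Performing the summation over `a`", before (4.6))] -/
theorem sum_kernel_complete_le {d : ℕ} (hd : 0 < d) (M N : ℕ) (B : Finset ℕ) (l : ℤ) :
    ∑ σ ∈ range d ×ˢ (B ×ˢ B),
        ‖∑ m ∈ range M, e (m * (((σ.2.1 : ℝ) - σ.2.2 - l) / N + σ.1 / d))‖ ^ 2 ≤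
      d * ∑ μ ∈ range M ×ˢ range M,
        (if (d : ℤ) ∣ ((μ.1 : ℤ) - μ.2) then
          ‖∑ b ∈ B, e ((b : ℝ) * (((μ.1 : ℤ) - μ.2 : ℤ) : ℝ) / N)‖ ^ 2 else 0) := by
  classical
  set F : ℤ → ℂ := fun m => ∑ b ∈ B, e ((b : ℝ) * m / N) with hF
  set x : ℕ × ℕ → ℝ := fun p => ((p.1 : ℝ) - p.2 - l) / N with hx
  -- the complexified left side
  have hC : ((∑ σ ∈ range d ×ˢ (B ×ˢ B),
      ‖∑ m ∈ range M, e (m * (((σ.2.1 : ℝ) - σ.2.2 - l) / N + σ.1 / d))‖ ^ 2 : ℝ) : ℂ) =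
      ∑ μ ∈ range M ×ˢ range M,
        (∑ a ∈ range d, e ((a : ℝ) * (((μ.1 : ℤ) - μ.2 : ℤ) : ℝ) / d)) *
          (e (-((((μ.1 : ℤ) - μ.2 : ℤ) : ℝ) * l / N)) *
            (F ((μ.1 : ℤ) - μ.2) * conj (F ((μ.1 : ℤ) - μ.2)))) := by
    rw [Complex.ofReal_sum]
    simp_rw [norm_sq_sum_e_eq_sum_prod]
    rw [Finset.sum_comm]
    refine Finset.sum_congr rfl fun μ _ => ?_
    -- factor the `σ`-sum
    rw [Finset.sum_product, Finset.sum_mul]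
    refine Finset.sum_congr rfl fun a _ => ?_
    rw [hF]
    simp only [map_sum]
    rw [Finset.sum_mul_sum, Finset.mul_sum, Finset.mul_sum, Finset.sum_product]
    refine Finset.sum_congr rfl fun b _ => ?_
    rw [Finset.mul_sum, Finset.mul_sum]
    refine Finset.sum_congr rfl fun b' _ => ?_
    rw [conj_e, ← e_add, ← e_add, ← e_add]
    congr 1; push_cast; ring
  have hre : ∑ σ ∈ range d ×ˢ (B ×ˢ B),
      ‖∑ m ∈ range M, e (m * (((σ.2.1 : ℝ) - σ.2.2 - l) / N + σ.1 / d))‖ ^ 2 =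
      ‖((∑ σ ∈ range d ×ˢ (B ×ˢ B),
        ‖∑ m ∈ range M, e (m * (((σ.2.1 : ℝ) - σ.2.2 - l) / N + σ.1 / d))‖ ^ 2 : ℝ) : ℂ)‖ := by
    rw [Complex.norm_real, Real.norm_eq_abs, abs_of_nonneg (Finset.sum_nonneg fun _ _ => sq_nonneg _)]
  rw [hre, hC, Finset.mul_sum]
  refine (norm_sum_le _ _).trans (Finset.sum_le_sum fun μ _ => ?_)
  rw [RamanujanSum.sum_range_fourierChar_div hd.ne', norm_mul, norm_mul, norm_e, one_mul,
    Complex.mul_conj', ← Complex.ofReal_pow, Complex.norm_real, Real.norm_eq_abs,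
    abs_of_nonneg (sq_nonneg _)]
  split_ifs with hdvd
  · rw [Complex.norm_natCast, hF]
  · rw [norm_zero, zero_mul, mul_zero]

/-- **Window bound**: for `M ≤ N` and `B ⊆ [0, N)`,
`∑_{m₂<M} |∑_{b ∈ B} e(b(m₁ - m₂)/N)|² ≤ N |B|` (the frequencies `m₁ - m₂` lie in a window of
`N` consecutive integers; Parseval). [folklore] -/
theorem sum_range_norm_sq_diff_le {N M : ℕ} (hN : 0 < N) (hMN : M ≤ N) {B : Finset ℕ}
    (hB : B ⊆ range N) (m₁ : ℕ) :
    ∑ m₂ ∈ range M, ‖∑ b ∈ B, e ((b : ℝ) * (((m₁ : ℤ) - m₂ : ℤ) : ℝ) / N)‖ ^ 2 ≤ N * B.card := by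
  classical
  set a : ℤ := (m₁ : ℤ) + 1 - N with ha
  have hP := sum_window_norm_sq_le hN hB (f := fun _ => (1 : ℂ)) (fun _ => by simp) a
  simp only [one_mul] at hP
  refine le_trans ?_ hP
  set g : ℕ → ℝ := fun j => ‖∑ b ∈ B, e ((b : ℝ) * ((a + j : ℤ) : ℝ) / N)‖ ^ 2 with hg
  have hinj : Set.InjOn (fun m₂ : ℕ => N - 1 - m₂) ↑(range M) := by
    intro i hi j hj h
    rw [Finset.coe_range, Set.mem_Iio] at hi hj
    simp only at h
    omega
  calc ∑ m₂ ∈ range M, ‖∑ b ∈ B, e ((b : ℝ) * (((m₁ : ℤ) - m₂ : ℤ) : ℝ) / N)‖ ^ 2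
      = ∑ m₂ ∈ range M, g (N - 1 - m₂) := by
        refine Finset.sum_congr rfl fun m₂ hm₂ => ?_
        rw [Finset.mem_range] at hm₂
        rw [hg]
        simp only
        congr 3
        ext b
        congr 2
        rw [ha]
        have : ((N - 1 - m₂ : ℕ) : ℤ) = (N : ℤ) - 1 - m₂ := by omega
        push_cast [this]
        ring
    _ = ∑ j ∈ (range M).image (fun m₂ => N - 1 - m₂), g j := (Finset.sum_image hinj).symm
    _ ≤ ∑ j ∈ range N, g j := by
        refine Finset.sum_le_sum_of_subset_of_nonneg ?_ fun j _ _ => by rw [hg]; positivity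
        intro j hj
        obtain ⟨m₂, hm₂, rfl⟩ := Finset.mem_image.1 hj
        rw [Finset.mem_range] at hm₂ ⊢
        omega

/-- A symmetric double sum of a nonnegative function of `|m₁ - m₂|` over `m₁ ≠ m₂ < M` is at
most `2M ∑_{n=1}^{M} h(n)` (each value `n` of `|m₁ - m₂|` arises from at most two `m₂`).
[folklore] -/
theorem sum_sum_offdiag_le {M : ℕ} (h : ℕ → ℝ) (hh : ∀ n, 0 ≤ h n) :
    ∑ m₁ ∈ range M, ∑ m₂ ∈ range M,
        (if m₁ = m₂ then 0 else h (((m₁ : ℤ) - m₂).natAbs)) ≤ 2 * M * ∑ n ∈ Icc 1 M, h n := by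
  classical
  have hrow : ∀ m₁ ∈ range M, ∑ m₂ ∈ range M,
      (if m₁ = m₂ then 0 else h (((m₁ : ℤ) - m₂).natAbs)) ≤ 2 * ∑ n ∈ Icc 1 M, h n := by
    intro m₁ hm₁
    rw [Finset.mem_range] at hm₁
    rw [← Finset.sum_filter_add_sum_filter_not (range M) (fun m₂ => m₁ = m₂)]
    have h0 : ∑ m₂ ∈ (range M).filter (fun m₂ => m₁ = m₂),
        (if m₁ = m₂ then 0 else h (((m₁ : ℤ) - m₂).natAbs)) = 0 :=
      Finset.sum_eq_zero fun m₂ hm₂ => by rw [if_pos (Finset.mem_filter.1 hm₂).2]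
    rw [h0, zero_add]
    set S := (range M).filter (fun m₂ => ¬ m₁ = m₂) with hS
    have h1 : ∑ m₂ ∈ S, (if m₁ = m₂ then 0 else h (((m₁ : ℤ) - m₂).natAbs)) =
        ∑ m₂ ∈ S, h (((m₁ : ℤ) - m₂).natAbs) :=
      Finset.sum_congr rfl fun m₂ hm₂ => by rw [if_neg (Finset.mem_filter.1 hm₂).2]
    rw [h1]
    -- fibre over `n = |m₁ - m₂|`
    have hmaps : ∀ m₂ ∈ S, ((m₁ : ℤ) - m₂).natAbs ∈ Icc 1 M := by
      intro m₂ hm₂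
      rw [hS, Finset.mem_filter, Finset.mem_range] at hm₂
      rw [Finset.mem_Icc]
      constructor <;> omega
    rw [← Finset.sum_fiberwise_of_maps_to hmaps, Finset.mul_sum]
    refine Finset.sum_le_sum fun n hn => ?_
    rw [Finset.mem_Icc] at hn
    have h2 : ∑ m₂ ∈ S.filter (fun m₂ : ℕ => ((m₁ : ℤ) - m₂).natAbs = n),
        h (((m₁ : ℤ) - m₂).natAbs) =
        (S.filter (fun m₂ : ℕ => ((m₁ : ℤ) - m₂).natAbs = n)).card * h n := by
      calc ∑ m₂ ∈ S.filter (fun m₂ : ℕ => ((m₁ : ℤ) - m₂).natAbs = n), h (((m₁ : ℤ) - m₂).natAbs)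
          = ∑ m₂ ∈ S.filter (fun m₂ : ℕ => ((m₁ : ℤ) - m₂).natAbs = n), h n :=
            Finset.sum_congr rfl fun m₂ hm₂ => by rw [(Finset.mem_filter.1 hm₂).2]
        _ = _ := by rw [Finset.sum_const, nsmul_eq_mul]
    rw [h2]
    refine mul_le_mul_of_nonneg_right ?_ (hh n)
    have hsub : S.filter (fun m₂ : ℕ => ((m₁ : ℤ) - m₂).natAbs = n) ⊆ {m₁ - n, m₁ + n} := by
      intro m₂ hm₂
      rw [Finset.mem_filter, hS, Finset.mem_filter] at hm₂
      rw [Finset.mem_insert, Finset.mem_singleton]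
      omega
    have := Finset.card_le_card hsub
    have h3 : ({m₁ - n, m₁ + n} : Finset ℕ).card ≤ 2 := Finset.card_le_two
    exact_mod_cast this.trans h3
  calc ∑ m₁ ∈ range M, ∑ m₂ ∈ range M, (if m₁ = m₂ then 0 else h (((m₁ : ℤ) - m₂).natAbs))
      ≤ ∑ m₁ ∈ range M, 2 * ∑ n ∈ Icc 1 M, h n := Finset.sum_le_sum hrow
    _ = 2 * M * ∑ n ∈ Icc 1 M, h n := by rw [Finset.sum_const, Finset.card_range, nsmul_eq_mul]; ring


/-! ### The small-denominator count `U_l` -/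

/-- The constant in the divisor-moment bound is `≪_r κ`:
`exp((2^r-1)(log log max(K,2) + 4)) ≤ C_r K` for `K ≥ 1` (`(log y)^a ≤ a! y`). [folklore] -/
theorem exists_const_divisor_moment (r : ℕ) :
    ∃ C : ℝ, 0 < C ∧ ∀ K : ℕ, 1 ≤ K →
      Real.exp (((2 : ℝ) ^ r - 1) * (Real.log (Real.log ((max K 2 : ℕ) : ℝ)) + 4)) ≤ C * K := by
  set a : ℕ := 2 ^ r - 1 with ha
  have ha' : ((2 : ℝ) ^ r - 1) = (a : ℝ) := by
    rw [ha, Nat.cast_sub (Nat.one_le_two_pow), Nat.cast_pow, Nat.cast_two, Nat.cast_one]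
  refine ⟨2 * Real.exp 4 ^ a * a.factorial, by positivity, fun K hK => ?_⟩
  set y : ℕ := max K 2 with hy
  have hy2 : (2 : ℝ) ≤ y := by rw [hy]; exact_mod_cast le_max_right K 2
  have hyK : (y : ℝ) ≤ 2 * K := by
    rw [hy]; push_cast
    have : (1 : ℝ) ≤ K := by exact_mod_cast hK
    rcases le_total (K : ℝ) 2 with h | h
    · rw [max_eq_right h]; linarith
    · rw [max_eq_left h]; linarith
  have hlog : 0 < Real.log y := Real.log_pos (by linarith)
  rw [ha', Real.exp_nat_mul, Real.exp_add, Real.exp_log hlog, mul_pow]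
  have h1 : Real.log y ^ a ≤ a.factorial * y := by
    have := Real.pow_div_factorial_le_exp (Real.log y) hlog.le a
    rw [Real.exp_log (by linarith), div_le_iff₀ (by positivity)] at this
    linarith
  calc Real.log y ^ a * Real.exp 4 ^ a ≤ (a.factorial * y) * Real.exp 4 ^ a := by gcongr
    _ ≤ (a.factorial * (2 * K)) * Real.exp 4 ^ a := by gcongr
    _ = 2 * Real.exp 4 ^ a * a.factorial * K := by ring

/-- The splitting inequality: for `0 ≤ F ≤ K₂`, `τ ≥ 0`, `Λ > 0`, `r ≥ 1`:
`F τ ≤ Λ F + K₂ τ^r / Λ^{r-1}` (if `τ > Λ` then `τ ≤ τ^r/Λ^{r-1}`). [folklore] -/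
theorem mul_le_split {F τ Λ K₂ : ℝ} {r : ℕ} (hF0 : 0 ≤ F) (hFK : F ≤ K₂) (hτ : 0 ≤ τ)
    (hΛ : 0 < Λ) (hr : 1 ≤ r) : F * τ ≤ Λ * F + K₂ * τ ^ r / Λ ^ (r - 1) := by
  have hK : 0 ≤ K₂ := hF0.trans hFK
  rcases le_or_gt τ Λ with h | h
  · have : 0 ≤ K₂ * τ ^ r / Λ ^ (r - 1) := by positivity
    nlinarith
  · obtain ⟨k, rfl⟩ : ∃ k, r = k + 1 := ⟨r - 1, by omega⟩
    simp only [Nat.add_sub_cancel]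
    have h1 : Λ ^ k * τ ≤ τ ^ (k + 1) := by
      rw [pow_succ]
      exact mul_le_mul_of_nonneg_right (pow_le_pow_left₀ hΛ.le h.le k) hτ
    have h2 : τ ≤ τ ^ (k + 1) / Λ ^ k := by
      rw [le_div_iff₀ (by positivity)]; linarith
    calc F * τ ≤ K₂ * (τ ^ (k + 1) / Λ ^ k) := mul_le_mul hFK h2 hτ hK
      _ = K₂ * τ ^ (k + 1) / Λ ^ k := by ring
      _ ≤ Λ * F + K₂ * τ ^ (k + 1) / Λ ^ k := by nlinarith

/-- The kernel `z ↦ |∑_{m<M} e(m(x + z))|` is `1`-periodic. [folklore] -/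
theorem norm_sum_e_add_int (M : ℕ) (x z : ℝ) (k : ℤ) :
    ‖∑ m ∈ range M, e (m * (x + (z + k)))‖ = ‖∑ m ∈ range M, e (m * (x + z))‖ := by
  congr 1
  refine Finset.sum_congr rfl fun m _ => ?_
  rw [show (m : ℝ) * (x + (z + k)) = m * (x + z) + ((m * k : ℤ) : ℝ) by push_cast; ring, e_add_int]

/-- **Abstract splitting bound** for the frequency-side double sum: with weights `c(m)`
(`c(0) ≤ κ^{1+ε}`, `c(m) ≤ κ^ε τ(|m|)` for `m ≠ 0`), energies `0 ≤ F ≤ κ²` with the window bound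
`∑_{m₂<M} F(m₁-m₂) ≤ Nκ`, and a moment bound `∑_{n ≤ M} τ(n)^r ≤ M C_E κ`,
`∑_{m₁,m₂<M} c(m₁-m₂) F(m₁-m₂) ≤ M κ^{3+ε} + κ^{3ε} M N κ + κ^{2+ε} Λ^{1-r} 2M² C_E κ`
(`Λ = κ^{2ε}`; split `τ ≤ Λ + τ^r Λ^{1-r}`). [cite: GreenTao2006Restriction, §4 (Hölder step after (4.6))] -/
theorem sum_sum_mul_le_of_split {ε κ CE : ℝ} {N M r : ℕ} (hκ1 : 1 ≤ κ) (hr1 : 1 ≤ r)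
    (c F : ℤ → ℝ) (τ : ℕ → ℝ) (hc0 : c 0 ≤ κ ^ (1 + ε))
    (hcm : ∀ m : ℤ, m ≠ 0 → c m ≤ κ ^ ε * τ m.natAbs) (hF0 : ∀ m, 0 ≤ F m)
    (hFκ : ∀ m, F m ≤ κ ^ 2) (hwin : ∀ m₁ ∈ range M, ∑ m₂ ∈ range M, F ((m₁ : ℤ) - m₂) ≤ N * κ)
    (hτ0 : ∀ n, 0 ≤ τ n) (hmom : ∑ n ∈ Icc 1 M, τ n ^ r ≤ M * (CE * κ)) :
    ∑ m₁ ∈ range M, ∑ m₂ ∈ range M, c ((m₁ : ℤ) - m₂) * F ((m₁ : ℤ) - m₂) ≤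
      M * (κ ^ (1 + ε) * κ ^ 2) + κ ^ ε * (κ ^ (2 * ε) * (M * (N * κ))) +
        κ ^ ε * (κ ^ 2 * (2 * M * (M * (CE * κ))) / (κ ^ (2 * ε)) ^ (r - 1)) := by
  have hκ0 : 0 < κ := by linarith
  set Λ : ℝ := κ ^ (2 * ε) with hΛ
  have hΛ0 : 0 < Λ := Real.rpow_pos_of_pos hκ0 _
  have hterm : ∀ m₁ ∈ range M, ∀ m₂ ∈ range M,
      c ((m₁ : ℤ) - m₂) * F ((m₁ : ℤ) - m₂) ≤
        (if m₁ = m₂ then κ ^ (1 + ε) * κ ^ 2 else 0) + κ ^ ε * (Λ * F ((m₁ : ℤ) - m₂)) +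
          κ ^ ε * (κ ^ 2 * (if m₁ = m₂ then 0 else τ (((m₁ : ℤ) - m₂).natAbs) ^ r) /
            Λ ^ (r - 1)) := by
    intro m₁ _ m₂ _
    by_cases hmm : m₁ = m₂
    · subst hmm
      rw [if_pos rfl, if_pos rfl, sub_self]
      have h1 : c 0 * F 0 ≤ κ ^ (1 + ε) * κ ^ 2 :=
        mul_le_mul hc0 (hFκ 0) (hF0 0) (Real.rpow_nonneg hκ0.le _)
      have h2 : 0 ≤ κ ^ ε * (Λ * F 0) :=
        mul_nonneg (Real.rpow_nonneg hκ0.le _) (mul_nonneg hΛ0.le (hF0 0))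
      have h3 : κ ^ ε * (κ ^ 2 * 0 / Λ ^ (r - 1)) = 0 := by simp
      linarith
    · rw [if_neg hmm, if_neg hmm, zero_add]
      have hm0 : ((m₁ : ℤ) - m₂) ≠ 0 := by omega
      have h1 := hcm _ hm0
      have hsplit := mul_le_split (hF0 ((m₁ : ℤ) - m₂)) (hFκ _) (hτ0 (((m₁ : ℤ) - m₂).natAbs))
        hΛ0 hr1
      calc c ((m₁ : ℤ) - m₂) * F ((m₁ : ℤ) - m₂)
          ≤ κ ^ ε * τ (((m₁ : ℤ) - m₂).natAbs) * F ((m₁ : ℤ) - m₂) :=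
            mul_le_mul_of_nonneg_right h1 (hF0 _)
        _ = κ ^ ε * (F ((m₁ : ℤ) - m₂) * τ (((m₁ : ℤ) - m₂).natAbs)) := by ring
        _ ≤ κ ^ ε * (Λ * F ((m₁ : ℤ) - m₂) +
              κ ^ 2 * τ (((m₁ : ℤ) - m₂).natAbs) ^ r / Λ ^ (r - 1)) :=
            mul_le_mul_of_nonneg_left hsplit (Real.rpow_nonneg hκ0.le _)
        _ = _ := by ring
  have hsum1 : ∑ m₁ ∈ range M, ∑ m₂ ∈ range M,
      (if m₁ = m₂ then κ ^ (1 + ε) * κ ^ 2 else (0 : ℝ)) = M * (κ ^ (1 + ε) * κ ^ 2) := by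
    have : ∀ m₁ ∈ range M, ∑ m₂ ∈ range M,
        (if m₁ = m₂ then κ ^ (1 + ε) * κ ^ 2 else (0 : ℝ)) = κ ^ (1 + ε) * κ ^ 2 := by
      intro m₁ hm₁
      rw [Finset.sum_ite_eq, if_pos hm₁]
    rw [Finset.sum_congr rfl this, Finset.sum_const, Finset.card_range, nsmul_eq_mul]
  have hsum2 : ∑ m₁ ∈ range M, ∑ m₂ ∈ range M, F ((m₁ : ℤ) - m₂) ≤ M * (N * κ) := by
    calc ∑ m₁ ∈ range M, ∑ m₂ ∈ range M, F ((m₁ : ℤ) - m₂) ≤ ∑ m₁ ∈ range M, N * κ :=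
          Finset.sum_le_sum hwin
      _ = M * (N * κ) := by rw [Finset.sum_const, Finset.card_range, nsmul_eq_mul]
  have hsum3 : ∑ m₁ ∈ range M, ∑ m₂ ∈ range M,
      (if m₁ = m₂ then 0 else τ (((m₁ : ℤ) - m₂).natAbs) ^ r) ≤ 2 * M * (M * (CE * κ)) :=
    (sum_sum_offdiag_le (fun n => τ n ^ r) fun n => pow_nonneg (hτ0 n) r).trans
      (mul_le_mul_of_nonneg_left hmom (by positivity))
  have hκε : 0 ≤ κ ^ ε := Real.rpow_nonneg hκ0.le _
  calc ∑ m₁ ∈ range M, ∑ m₂ ∈ range M, c ((m₁ : ℤ) - m₂) * F ((m₁ : ℤ) - m₂)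
      ≤ ∑ m₁ ∈ range M, ∑ m₂ ∈ range M,
          ((if m₁ = m₂ then κ ^ (1 + ε) * κ ^ 2 else 0) + κ ^ ε * (Λ * F ((m₁ : ℤ) - m₂)) +
            κ ^ ε * (κ ^ 2 * (if m₁ = m₂ then 0 else τ (((m₁ : ℤ) - m₂).natAbs) ^ r) /
              Λ ^ (r - 1))) :=
        Finset.sum_le_sum fun m₁ hm₁ => Finset.sum_le_sum fun m₂ hm₂ => hterm m₁ hm₁ m₂ hm₂
    _ = (∑ m₁ ∈ range M, ∑ m₂ ∈ range M, (if m₁ = m₂ then κ ^ (1 + ε) * κ ^ 2 else (0 : ℝ))) +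
          (∑ m₁ ∈ range M, ∑ m₂ ∈ range M, κ ^ ε * (Λ * F ((m₁ : ℤ) - m₂))) +
          ∑ m₁ ∈ range M, ∑ m₂ ∈ range M,
            κ ^ ε * (κ ^ 2 * (if m₁ = m₂ then 0 else τ (((m₁ : ℤ) - m₂).natAbs) ^ r) /
              Λ ^ (r - 1)) := by
        simp only [Finset.sum_add_distrib]
    _ ≤ _ := by
        have hX : ∑ m₁ ∈ range M, ∑ m₂ ∈ range M, κ ^ ε * (Λ * F ((m₁ : ℤ) - m₂)) =
            κ ^ ε * (Λ * ∑ m₁ ∈ range M, ∑ m₂ ∈ range M, F ((m₁ : ℤ) - m₂)) := by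
          simp only [Finset.mul_sum]
        have hY : ∑ m₁ ∈ range M, ∑ m₂ ∈ range M,
            κ ^ ε * (κ ^ 2 * (if m₁ = m₂ then 0 else τ (((m₁ : ℤ) - m₂).natAbs) ^ r) /
              Λ ^ (r - 1)) =
            κ ^ ε * (κ ^ 2 * (∑ m₁ ∈ range M, ∑ m₂ ∈ range M,
              (if m₁ = m₂ then 0 else τ (((m₁ : ℤ) - m₂).natAbs) ^ r)) / Λ ^ (r - 1)) := by
          simp only [Finset.mul_sum, Finset.sum_div]
        have h2 : κ ^ ε * (Λ * ∑ m₁ ∈ range M, ∑ m₂ ∈ range M, F ((m₁ : ℤ) - m₂)) ≤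
            κ ^ ε * (Λ * (M * (N * κ))) :=
          mul_le_mul_of_nonneg_left (mul_le_mul_of_nonneg_left hsum2 hΛ0.le) hκε
        have h3 : κ ^ ε * (κ ^ 2 * (∑ m₁ ∈ range M, ∑ m₂ ∈ range M,
            (if m₁ = m₂ then 0 else τ (((m₁ : ℤ) - m₂).natAbs) ^ r)) / Λ ^ (r - 1)) ≤
            κ ^ ε * (κ ^ 2 * (2 * M * (M * (CE * κ))) / Λ ^ (r - 1)) := by
          refine mul_le_mul_of_nonneg_left ?_ hκε
          exact div_le_div_of_nonneg_right (mul_le_mul_of_nonneg_left hsum3 (sq_nonneg κ))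
            (pow_nonneg hΛ0.le _)
        rw [hsum1, hX, hY]
        linarith

/-- The final numerology of the small-denominator count: with `κ² ≤ N ≤ 16M`, `εr ≥ 1`,
`4M⁻² A (M κ^{3+ε} + κ^{3ε} M N κ + 2 κ^{2+ε} (κ^{2ε})^{1-r} M² C_E κ) ≤ (128 + 8C_E) A κ^{1+3ε}`.
[folklore] -/
theorem small_den_numerology {ε κ CE A : ℝ} {N : ℕ} {M : ℝ} {r : ℕ} (hε : 0 < ε)
    (hεr : 1 ≤ ε * r) (hr1 : 1 ≤ r) (hCE : 0 ≤ CE) (hA : 0 ≤ A) (hκ1 : 1 ≤ κ) (hM0 : 0 < M)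
    (hκN : κ ^ 2 ≤ N) (hNM : (N : ℝ) ≤ 16 * M) :
    4 / M ^ 2 * (A * (M * (κ ^ (1 + ε) * κ ^ 2) + κ ^ ε * (κ ^ (2 * ε) * (M * (N * κ))) +
      κ ^ ε * (κ ^ 2 * (2 * M * (M * (CE * κ))) / (κ ^ (2 * ε)) ^ (r - 1)))) ≤
      (128 + 8 * CE) * A * κ ^ (1 + 3 * ε) := by
  have hκ0 : 0 < κ := by linarith
  set Λ : ℝ := κ ^ (2 * ε) with hΛ
  have hΛ0 : 0 < Λ := Real.rpow_pos_of_pos hκ0 _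
  have h16a : κ ^ 2 / M ≤ 16 := by rw [div_le_iff₀ hM0]; linarith
  have h16b : (N : ℝ) / M ≤ 16 := by rw [div_le_iff₀ hM0]; linarith
  have hexp1 : κ ^ (1 + ε) ≤ κ ^ (1 + 3 * ε) :=
    Real.rpow_le_rpow_of_exponent_le hκ1 (by linarith)
  have hexp2 : κ ^ ε * (Λ * κ) = κ ^ (1 + 3 * ε) := by
    rw [hΛ, ← mul_assoc, ← Real.rpow_add hκ0, ← Real.rpow_add_one hκ0.ne']
    congr 1; ring
  have hexp3 : κ ^ ε * (κ ^ 2 * κ) / Λ ^ (r - 1) ≤ κ ^ (1 + 3 * ε) := by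
    have hr' : ((r - 1 : ℕ) : ℝ) = r - 1 := by rw [Nat.cast_sub hr1, Nat.cast_one]
    have h1 : Λ ^ (r - 1) = κ ^ (2 * ε * (r - 1)) := by
      rw [hΛ, ← Real.rpow_natCast, ← Real.rpow_mul hκ0.le, hr']
    have h2 : κ ^ ε * (κ ^ 2 * κ) / Λ ^ (r - 1) = κ ^ (ε + 3 - 2 * ε * (r - 1)) := by
      rw [h1, Real.rpow_sub hκ0, Real.rpow_add hκ0]
      congr 2
      rw [show (3 : ℝ) = ((3 : ℕ) : ℝ) by norm_num, Real.rpow_natCast]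
      ring
    rw [h2]
    exact Real.rpow_le_rpow_of_exponent_le hκ1 (by nlinarith)
  have hkey : 4 / M ^ 2 * (A * (M * (κ ^ (1 + ε) * κ ^ 2) + κ ^ ε * (Λ * (M * (N * κ))) +
      κ ^ ε * (κ ^ 2 * (2 * M * (M * (CE * κ))) / Λ ^ (r - 1)))) =
      4 * A * (κ ^ (1 + ε) * (κ ^ 2 / M) + κ ^ ε * (Λ * κ) * (N / M) +
        2 * CE * (κ ^ ε * (κ ^ 2 * κ) / Λ ^ (r - 1))) := by
    field_simp
  rw [hkey, hexp2]
  have hκ13 : 0 ≤ κ ^ (1 + 3 * ε) := Real.rpow_nonneg hκ0.le _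
  have t1 : κ ^ (1 + ε) * (κ ^ 2 / M) ≤ κ ^ (1 + 3 * ε) * 16 :=
    mul_le_mul hexp1 h16a (div_nonneg (sq_nonneg κ) hM0.le) hκ13
  have t2 : κ ^ (1 + 3 * ε) * ((N : ℝ) / M) ≤ κ ^ (1 + 3 * ε) * 16 :=
    mul_le_mul_of_nonneg_left h16b hκ13
  have t3 : 2 * CE * (κ ^ ε * (κ ^ 2 * κ) / Λ ^ (r - 1)) ≤ 2 * CE * κ ^ (1 + 3 * ε) :=
    mul_le_mul_of_nonneg_left hexp3 (by positivity)
  nlinarith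

open Classical in
/-- **The small-denominator count** (the heart of the proof of GT Prop. 4.1, (4.5)–(4.6)): there
is `C = C(ε)` such that for all data as in `restriction_set_estimate` and every integer shift
`l`, the weighted number of `(b, b', i)` with `q_i ≤ |B|` and `(b-b')/N + θ_i - l/N` within `1/N`
of an integer is at most `C A |B|^{1+3ε}` (for `|B|² ≤ N`, `N ≥ 16`).  Proof: positive Fejér
majorant of the indicator, completion of `a ∈ ℤ_q^*` to `ℤ_q`, orthogonality (`∑_a e(am/q) = q 1_{q∣m}`),
Parseval, and the moment bound for the restricted divisor function.
[cite: GreenTao2006Restriction, §4 (4.5)–(4.6)] -/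
theorem small_den_count_le {ε : ℝ} (hε : 0 < ε) :
    ∃ C : ℝ, 0 < C ∧ ∀ {ι : Type*} (T : Finset ι) (θ : ι → ℝ) (q : ι → ℕ) (w : ι → ℂ) (A : ℝ),
      0 ≤ A → (∀ i ∈ T, 1 ≤ q i ∧ Squarefree (q i)) → (∀ i ∈ T, ∃ a : ℤ, θ i = a / q i) →
      (∀ i ∈ T, ∀ j ∈ T, i ≠ j → ∀ m : ℤ, θ i - θ j ≠ m) →
      (∀ i ∈ T, ‖w i‖ ≤ A * (q i : ℝ) ^ (ε - 1)) →
      ∀ {N : ℕ}, 16 ≤ N → ∀ (B : Finset ℕ), B ⊆ range N → B.Nonempty →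
      ((B.card : ℝ) ^ 2 ≤ N) → ∀ l : ℤ,
        ∑ b ∈ B, ∑ b' ∈ B, ∑ i ∈ T.filter (fun i => (q i : ℝ) ≤ B.card),
          ‖w i‖ * (if ∃ m : ℤ, |((b : ℝ) - b') / N + θ i - l / N - m| ≤ 1 / N
            then (1 : ℝ) else 0) ≤ C * A * (B.card : ℝ) ^ (1 + 3 * ε) := by
  -- the exponent `r` and the divisor-moment constant
  set r : ℕ := ⌈1 / ε⌉₊ with hr
  have hr1 : 1 ≤ r := by
    rw [hr, Nat.one_le_ceil_iff]; positivity
  have hεr : 1 ≤ ε * r := by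
    have : 1 / ε ≤ r := Nat.le_ceil _
    rwa [div_le_iff₀ hε, mul_comm] at this
  obtain ⟨CE, hCE, hCEb⟩ := exists_const_divisor_moment r
  refine ⟨128 + 8 * CE, by positivity, ?_⟩
  intro ι T θ q w A hA hq hθ hsep hw N hN B hB hBne hBN l
  -- notation
  set K : ℕ := B.card with hKdef
  have hK1n : 1 ≤ K := Finset.card_pos.2 hBne
  set κ : ℝ := (K : ℝ) with hκ
  have hκ1 : 1 ≤ κ := by rw [hκ]; exact_mod_cast hK1n
  have hκ0 : 0 < κ := by linarith
  have hN0 : 0 < N := by omega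
  have hN0r : (0 : ℝ) < N := by exact_mod_cast hN0
  set M : ℕ := N / 8 with hM
  have hM8 : 8 * M ≤ N := by rw [hM]; omega
  have hM1 : 2 ≤ M := by rw [hM]; omega
  have hMN : M ≤ N := by omega
  have hNM : (N : ℝ) ≤ 16 * M := by
    have : N ≤ 16 * M := by rw [hM]; omega
    exact_mod_cast this
  have hM0 : (0 : ℝ) < M := by exact_mod_cast (by omega : 0 < M)
  set T' := T.filter (fun i => (q i : ℝ) ≤ K) with hT'
  set x : ℕ → ℕ → ℝ := fun b b' => ((b : ℝ) - b' - l) / N with hx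
  set Kz : ℝ → ℝ := fun z => ‖∑ m ∈ range M, e (m * z)‖ ^ 2 with hKz
  set F : ℤ → ℝ := fun m => ‖∑ b ∈ B, e ((b : ℝ) * m / N)‖ ^ 2 with hF
  -- Step A: positive kernel
  have hA' : ∀ b ∈ B, ∀ b' ∈ B, ∀ i ∈ T',
      ‖w i‖ * (if ∃ m : ℤ, |((b : ℝ) - b') / N + θ i - l / N - m| ≤ 1 / N
        then (1 : ℝ) else 0) ≤ 4 / (M : ℝ) ^ 2 * (‖w i‖ * Kz (x b b' + θ i)) := by
    intro b _ b' _ i _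
    have h := indicator_near_le_kernel hN0 hM8 (by omega) (((b : ℝ) - b') / N + θ i - l / N)
    have heq : ((b : ℝ) - b') / N + θ i - l / N = x b b' + θ i := by
      rw [hx]; simp only; ring
    rw [heq] at h
    rw [heq]
    calc ‖w i‖ * (if ∃ m : ℤ, |x b b' + θ i - m| ≤ 1 / N then (1 : ℝ) else 0)
        ≤ ‖w i‖ * (4 / (M : ℝ) ^ 2 * Kz (x b b' + θ i)) :=
          mul_le_mul_of_nonneg_left h (norm_nonneg _)
      _ = _ := by ring
  refine (Finset.sum_le_sum fun b hb => Finset.sum_le_sum fun b' hb' =>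
    Finset.sum_le_sum fun i hi => hA' b hb b' hb' i hi).trans ?_
  -- Step B: reorder to `∑_i ‖w_i‖ S_i`
  set S : ι → ℝ := fun i => ∑ b ∈ B, ∑ b' ∈ B, Kz (x b b' + θ i) with hS
  have hS0 : ∀ i, 0 ≤ S i := fun i =>
    Finset.sum_nonneg fun _ _ => Finset.sum_nonneg fun _ _ => by rw [hKz]; positivity
  have hB' : ∑ b ∈ B, ∑ b' ∈ B, ∑ i ∈ T', 4 / (M : ℝ) ^ 2 * (‖w i‖ * Kz (x b b' + θ i)) =
      4 / (M : ℝ) ^ 2 * ∑ i ∈ T', ‖w i‖ * S i := by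
    rw [Finset.mul_sum]
    calc ∑ b ∈ B, ∑ b' ∈ B, ∑ i ∈ T', 4 / (M : ℝ) ^ 2 * (‖w i‖ * Kz (x b b' + θ i))
        = ∑ b ∈ B, ∑ i ∈ T', ∑ b' ∈ B, 4 / (M : ℝ) ^ 2 * (‖w i‖ * Kz (x b b' + θ i)) :=
          Finset.sum_congr rfl fun _ _ => Finset.sum_comm
      _ = ∑ i ∈ T', ∑ b ∈ B, ∑ b' ∈ B, 4 / (M : ℝ) ^ 2 * (‖w i‖ * Kz (x b b' + θ i)) :=
          Finset.sum_comm
      _ = ∑ i ∈ T', 4 / (M : ℝ) ^ 2 * (‖w i‖ * S i) := by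
          refine Finset.sum_congr rfl fun i _ => ?_
          rw [hS]; simp only [Finset.mul_sum]
  rw [hB']
  -- Step C: the weight bound
  have hC' : ∑ i ∈ T', ‖w i‖ * S i ≤ ∑ i ∈ T', A * (q i : ℝ) ^ (ε - 1) * S i :=
    Finset.sum_le_sum fun i hi => mul_le_mul_of_nonneg_right (hw i (Finset.mem_filter.1 hi).1) (hS0 i)
  -- Step D/E: group by the denominator, complete and use orthogonality
  set Φ : ℕ → ℝ := fun dd => ∑ m₁ ∈ range M, ∑ m₂ ∈ range M,
    (if (dd : ℤ) ∣ ((m₁ : ℤ) - m₂) then F ((m₁ : ℤ) - m₂) else 0) with hΦ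
  have hΦ0 : ∀ dd, 0 ≤ Φ dd := fun dd =>
    Finset.sum_nonneg fun _ _ => Finset.sum_nonneg fun _ _ => by
      split_ifs
      · rw [hF]; positivity
      · exact le_rfl
  have hmaps : ∀ i ∈ T', q i ∈ Icc 1 K := by
    intro i hi
    rw [hT', Finset.mem_filter] at hi
    rw [Finset.mem_Icc]
    exact ⟨(hq i hi.1).1, by exact_mod_cast hi.2⟩
  have hfib : ∀ dd ∈ Icc 1 K, ∑ i ∈ T'.filter (fun i => q i = dd), S i ≤
      if Squarefree dd then (dd : ℝ) * Φ dd else 0 := by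
    intro dd hdd
    rw [Finset.mem_Icc] at hdd
    have hdd0 : 0 < dd := hdd.1
    split_ifs with hsq
    · -- completion
      set Tdd := T'.filter (fun i => q i = dd) with hTdd
      have hθ' : ∀ i ∈ Tdd, ∃ a : ℤ, θ i = a / dd := by
        intro i hi
        rw [hTdd, Finset.mem_filter, hT', Finset.mem_filter] at hi
        obtain ⟨a, ha⟩ := hθ i hi.1.1
        exact ⟨a, by rw [ha, hi.2]⟩
      have hsep'' : ∀ i ∈ Tdd, ∀ j ∈ Tdd, i ≠ j → ∀ m : ℤ, θ i - θ j ≠ m := by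
        intro i hi j hj hij m
        rw [hTdd, Finset.mem_filter, hT', Finset.mem_filter] at hi hj
        exact hsep i hi.1.1 j hj.1.1 hij m
      set g : ℝ → ℝ := fun z => ∑ b ∈ B, ∑ b' ∈ B, Kz (x b b' + z) with hg
      have hg0 : ∀ z, 0 ≤ g z := fun z =>
        Finset.sum_nonneg fun _ _ => Finset.sum_nonneg fun _ _ => by rw [hKz]; positivity
      have hgper : ∀ (z : ℝ) (k : ℤ), g (z + k) = g z := by
        intro z k
        rw [hg]
        refine Finset.sum_congr rfl fun b _ => Finset.sum_congr rfl fun b' _ => ?_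
        rw [hKz]
        simp only
        rw [norm_sum_e_add_int]
      have hcomp := sum_le_sum_range_of_periodic Tdd θ hdd0 hθ' hsep'' g hg0 hgper
      have hS' : ∑ i ∈ Tdd, S i = ∑ i ∈ Tdd, g (θ i) := rfl
      rw [hS']
      refine hcomp.trans ?_
      -- orthogonality
      have horth := sum_kernel_complete_le hdd0 M N B l
      rw [Finset.sum_product] at horth
      have hlhs : ∑ a ∈ range dd, g ((a : ℝ) / dd) =
          ∑ a ∈ range dd, ∑ y ∈ B ×ˢ B,
            ‖∑ m ∈ range M, e (m * ((((a, y).2.1 : ℝ) - (a, y).2.2 - l) / N + (a, y).1 / dd))‖ ^ 2 := by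
        refine Finset.sum_congr rfl fun a _ => ?_
        rw [hg, Finset.sum_product]
      rw [hlhs]
      refine horth.trans (le_of_eq ?_)
      rw [hΦ, Finset.sum_product]
    · refine le_of_eq (Finset.sum_eq_zero fun i hi => ?_)
      exfalso
      rw [Finset.mem_filter, hT', Finset.mem_filter] at hi
      exact hsq (hi.2 ▸ (hq i hi.1.1).2)
  have hDE : ∑ i ∈ T', A * (q i : ℝ) ^ (ε - 1) * S i ≤
      A * ∑ dd ∈ Icc 1 K, (if Squarefree dd then (dd : ℝ) ^ ε * Φ dd else 0) := by
    rw [← Finset.sum_fiberwise_of_maps_to hmaps, Finset.mul_sum]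
    refine Finset.sum_le_sum fun dd hdd => ?_
    have hdd1 : (1 : ℝ) ≤ dd := by exact_mod_cast (Finset.mem_Icc.1 hdd).1
    have hdd0 : (0 : ℝ) < dd := by linarith
    calc ∑ i ∈ T'.filter (fun i => q i = dd), A * (q i : ℝ) ^ (ε - 1) * S i
        = A * (dd : ℝ) ^ (ε - 1) * ∑ i ∈ T'.filter (fun i => q i = dd), S i := by
          rw [Finset.mul_sum]
          exact Finset.sum_congr rfl fun i hi => by rw [(Finset.mem_filter.1 hi).2]
      _ ≤ A * (dd : ℝ) ^ (ε - 1) * (if Squarefree dd then (dd : ℝ) * Φ dd else 0) :=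
          mul_le_mul_of_nonneg_left (hfib dd hdd) (by positivity)
      _ = A * (if Squarefree dd then (dd : ℝ) ^ ε * Φ dd else 0) := by
          split_ifs
          · rw [show (dd : ℝ) ^ ε = (dd : ℝ) ^ (ε - 1) * dd by
              rw [Real.rpow_sub_one hdd0.ne', div_mul_cancel₀ _ hdd0.ne']]
            ring
          · rw [mul_zero, mul_zero]
  -- Step F: swap to the frequency side
  set c : ℤ → ℝ := fun m => ∑ dd ∈ (Icc 1 K).filter (fun dd : ℕ => Squarefree dd ∧ (dd : ℤ) ∣ m),
    (dd : ℝ) ^ ε with hc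
  have hF' : ∑ dd ∈ Icc 1 K, (if Squarefree dd then (dd : ℝ) ^ ε * Φ dd else 0) =
      ∑ m₁ ∈ range M, ∑ m₂ ∈ range M, c ((m₁ : ℤ) - m₂) * F ((m₁ : ℤ) - m₂) := by
    have h1 : ∀ dd ∈ Icc 1 K, (if Squarefree dd then (dd : ℝ) ^ ε * Φ dd else 0) =
        ∑ m₁ ∈ range M, ∑ m₂ ∈ range M,
          (if Squarefree dd ∧ (dd : ℤ) ∣ ((m₁ : ℤ) - m₂) then (dd : ℝ) ^ ε else 0) *
            F ((m₁ : ℤ) - m₂) := by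
      intro dd _
      by_cases hsq : Squarefree dd
      · rw [if_pos hsq, hΦ, Finset.mul_sum]
        refine Finset.sum_congr rfl fun m₁ _ => ?_
        rw [Finset.mul_sum]
        refine Finset.sum_congr rfl fun m₂ _ => ?_
        by_cases hdv : (dd : ℤ) ∣ ((m₁ : ℤ) - m₂)
        · rw [if_pos hdv, if_pos ⟨hsq, hdv⟩]
        · rw [if_neg hdv, if_neg (fun h => hdv h.2), mul_zero, zero_mul]
      · rw [if_neg hsq]
        refine (Finset.sum_eq_zero fun m₁ _ => Finset.sum_eq_zero fun m₂ _ => ?_).symm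
        rw [if_neg (fun h => hsq h.1), zero_mul]
    rw [Finset.sum_congr rfl h1, Finset.sum_comm]
    refine Finset.sum_congr rfl fun m₁ _ => ?_
    rw [Finset.sum_comm]
    refine Finset.sum_congr rfl fun m₂ _ => ?_
    rw [← Finset.sum_mul]
    simp only [hc]
    rw [Finset.sum_filter]
  -- Step G: bounds for `c`
  have hc0 : c 0 ≤ κ ^ (1 + ε) := by
    simp only [hc]
    calc ∑ dd ∈ (Icc 1 K).filter (fun dd : ℕ => Squarefree dd ∧ (dd : ℤ) ∣ 0), (dd : ℝ) ^ ε
        ≤ ∑ dd ∈ (Icc 1 K).filter (fun dd : ℕ => Squarefree dd ∧ (dd : ℤ) ∣ 0), κ ^ ε := by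
          refine Finset.sum_le_sum fun dd hdd => ?_
          have := (Finset.mem_Icc.1 (Finset.mem_filter.1 hdd).1)
          exact Real.rpow_le_rpow (by positivity) (by rw [hκ]; exact_mod_cast this.2) hε.le
      _ = ((Icc 1 K).filter (fun dd : ℕ => Squarefree dd ∧ (dd : ℤ) ∣ 0)).card * κ ^ ε := by
          rw [Finset.sum_const, nsmul_eq_mul]
      _ ≤ κ * κ ^ ε := by
          refine mul_le_mul_of_nonneg_right ?_ (by positivity)
          have := Finset.card_le_card (Finset.filter_subset
            (fun dd : ℕ => Squarefree dd ∧ (dd : ℤ) ∣ 0) (Icc 1 K))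
          rw [Nat.card_Icc, Nat.add_sub_cancel] at this
          rw [hκ]; exact_mod_cast this
      _ = κ ^ (1 + ε) := by rw [Real.rpow_add hκ0, Real.rpow_one]
  have hcm : ∀ m : ℤ, m ≠ 0 → c m ≤ κ ^ ε *
      (((Icc 1 K).filter (fun dd => Squarefree dd ∧ dd ∣ m.natAbs)).card : ℝ) := by
    intro m _
    simp only [hc]
    have hset : (Icc 1 K).filter (fun dd : ℕ => Squarefree dd ∧ (dd : ℤ) ∣ m) =
        (Icc 1 K).filter (fun dd : ℕ => Squarefree dd ∧ dd ∣ m.natAbs) := by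
      refine Finset.filter_congr fun dd _ => ?_
      rw [Int.natCast_dvd]
    rw [hset]
    calc ∑ dd ∈ (Icc 1 K).filter (fun dd => Squarefree dd ∧ dd ∣ m.natAbs), (dd : ℝ) ^ ε
        ≤ ∑ dd ∈ (Icc 1 K).filter (fun dd => Squarefree dd ∧ dd ∣ m.natAbs), κ ^ ε := by
          refine Finset.sum_le_sum fun dd hdd => ?_
          have := (Finset.mem_Icc.1 (Finset.mem_filter.1 hdd).1)
          exact Real.rpow_le_rpow (by positivity) (by rw [hκ]; exact_mod_cast this.2) hε.le
      _ = _ := by rw [Finset.sum_const, nsmul_eq_mul, mul_comm]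
  -- Step H: apply the abstract splitting bound and the numerology
  have hF0 : ∀ m, 0 ≤ F m := fun m => by rw [hF]; positivity
  have hFκ : ∀ m, F m ≤ κ ^ 2 := by
    intro m
    rw [hF]
    simp only
    have h1 : ‖∑ b ∈ B, e ((b : ℝ) * m / N)‖ ≤ κ := by
      have := norm_sum_mul_e_le_card (B := B) (f := fun _ => (1 : ℂ)) (fun _ => by simp)
        (fun b => (b : ℝ) * m / N)
      simp only [one_mul] at this
      rw [hκ, hKdef]; exact this
    exact pow_le_pow_left₀ (norm_nonneg _) h1 2
  have hwin : ∀ m₁ ∈ range M, ∑ m₂ ∈ range M, F ((m₁ : ℤ) - m₂) ≤ N * κ := by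
    intro m₁ _
    have := sum_range_norm_sq_diff_le hN0 hMN hB m₁
    rw [hκ, hKdef]
    exact this
  set τ : ℕ → ℝ := fun n => (((Icc 1 K).filter (fun dd => Squarefree dd ∧ dd ∣ n)).card : ℝ)
    with hτ
  have hτ0 : ∀ n, 0 ≤ τ n := fun n => by rw [hτ]; positivity
  have hcm' : ∀ m : ℤ, m ≠ 0 → c m ≤ κ ^ ε * τ m.natAbs := fun m hm => hcm m hm
  have hmomτ : ∑ n ∈ Icc 1 M, τ n ^ r ≤ M * (CE * κ) := by
    set y : ℕ := max K 2 with hy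
    have hy2 : 2 ≤ y := le_max_right _ _
    have hKy : K ≤ y := le_max_left _ _
    have hmom := Literature.NumberTheory.Sieve.sum_pow_card_sqfreeDivisors_le r hy2 M
    have hτy : ∀ n, τ n ^ r ≤
        ((((Icc 1 y).filter (fun d => Squarefree d ∧ d ∣ n)).card : ℝ)) ^ r := by
      intro n
      refine pow_le_pow_left₀ (hτ0 n) ?_ r
      show (((Icc 1 K).filter (fun dd => Squarefree dd ∧ dd ∣ n)).card : ℝ) ≤ _
      exact_mod_cast Finset.card_le_card (Finset.filter_subset_filter _
        (Finset.Icc_subset_Icc_right hKy))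
    calc ∑ n ∈ Icc 1 M, τ n ^ r
        ≤ ∑ n ∈ Icc 1 M, ((((Icc 1 y).filter (fun d => Squarefree d ∧ d ∣ n)).card : ℝ)) ^ r :=
          Finset.sum_le_sum fun n _ => hτy n
      _ ≤ M * Real.exp (((2 : ℝ) ^ r - 1) * (Real.log (Real.log y) + 4)) := hmom
      _ ≤ M * (CE * κ) := by
          refine mul_le_mul_of_nonneg_left ?_ (Nat.cast_nonneg M)
          rw [hκ]
          exact hCEb K hK1n
  have hsplit := sum_sum_mul_le_of_split hκ1 hr1 c F τ hc0 hcm' hF0 hFκ hwin hτ0 hmomτ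
  have hκN : κ ^ 2 ≤ N := by rw [hκ, hKdef]; exact hBN
  calc 4 / (M : ℝ) ^ 2 * ∑ i ∈ T', ‖w i‖ * S i
      ≤ 4 / (M : ℝ) ^ 2 * (A * ∑ m₁ ∈ range M, ∑ m₂ ∈ range M,
          c ((m₁ : ℤ) - m₂) * F ((m₁ : ℤ) - m₂)) := by
        rw [← hF']
        exact mul_le_mul_of_nonneg_left (hC'.trans hDE) (by positivity)
    _ ≤ 4 / (M : ℝ) ^ 2 * (A * (M * (κ ^ (1 + ε) * κ ^ 2) +
          κ ^ ε * (κ ^ (2 * ε) * (M * (N * κ))) +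
          κ ^ ε * (κ ^ 2 * (2 * M * (M * (CE * κ))) / (κ ^ (2 * ε)) ^ (r - 1)))) := by gcongr
    _ ≤ (128 + 8 * CE) * A * κ ^ (1 + 3 * ε) :=
        small_den_numerology hε hεr hr1 hCE.le hA hκ1 hM0 hκN hNM


/-! ### Case B: `|B|² ≤ N` — the Fourier argument -/

/-- `∑_{j ≤ J} 4^{-j} (2·2^j + 1) ≤ 6`. [folklore] -/
theorem sum_dyadic_weights_le (J : ℕ) :
    ∑ j ∈ range (J + 1), (4 : ℝ)⁻¹ ^ j * (2 * 2 ^ j + 1) ≤ 6 := by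
  have h1 : ∀ j : ℕ, (4 : ℝ)⁻¹ ^ j * (2 * 2 ^ j + 1) = 2 * (1 / 2) ^ j + (1 / 4) ^ j := by
    intro j
    rw [show (4 : ℝ)⁻¹ = (1 / 2) * (1 / 2) by norm_num, mul_pow]
    have : ((1 : ℝ) / 2) ^ j * 2 ^ j = 1 := by rw [← mul_pow]; norm_num
    calc ((1 : ℝ) / 2) ^ j * (1 / 2) ^ j * (2 * 2 ^ j + 1)
        = 2 * (1 / 2) ^ j * ((1 / 2) ^ j * 2 ^ j) + (1 / 2) ^ j * (1 / 2) ^ j := by ring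
      _ = 2 * (1 / 2) ^ j + (1 / 4) ^ j := by rw [this, ← mul_pow]; norm_num
  simp_rw [h1]
  rw [Finset.sum_add_distrib, ← Finset.mul_sum]
  have h2 := sum_geometric_two_le (J + 1)
  have h3 : ∑ j ∈ range (J + 1), ((1 : ℝ) / 4) ^ j ≤ 4 / 3 := by
    have := geom_sum_Ico_le_of_lt_one (m := 0) (n := J + 1) (x := (1 : ℝ) / 4) (by norm_num)
      (by norm_num)
    rw [Finset.range_eq_Ico]
    refine this.trans ?_
    norm_num
  linarith

open Classical in
/-- Distributing the dyadic majorant: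
`∑_{b,b',i} |w_i| |D(y_{b,b',i})|² ≤ 4N² ∑_{j ≤ N} 4^{-j} V_j`,
`V_j = ∑_{b,b',i} |w_i| 1[y_{b,b',i} within 2^j/N of ℤ]`. [folklore] -/
theorem sum_kernel_le_dyadic {ι : Type*} (T : Finset ι) (θ : ι → ℝ) (w : ι → ℂ) {N : ℕ}
    (hN : 0 < N) (B : Finset ℕ) :
    ∑ b ∈ B, ∑ b' ∈ B, ∑ i ∈ T, ‖w i‖ *
        ‖∑ j ∈ range (2 * N), e (j * (((b : ℝ) - b') / N + θ i))‖ ^ 2 ≤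
      4 * (N : ℝ) ^ 2 * ∑ j ∈ range (N + 1), (4 : ℝ)⁻¹ ^ j *
        ∑ b ∈ B, ∑ b' ∈ B, ∑ i ∈ T, ‖w i‖ *
          (if ∃ m : ℤ, |((b : ℝ) - b') / N + θ i - m| ≤ 2 ^ j / N then (1 : ℝ) else 0) := by
  set y : ℕ → ℕ → ι → ℝ := fun b b' i => ((b : ℝ) - b') / N + θ i with hy
  set a : ℕ → ℝ := fun j => (4 : ℝ)⁻¹ ^ j with ha
  set I : ℕ → ℝ → ℝ := fun j z => if ∃ m : ℤ, |z - m| ≤ 2 ^ j / N then (1 : ℝ) else 0 with hI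
  have hterm : ∀ b ∈ B, ∀ b' ∈ B, ∀ i ∈ T,
      ‖w i‖ * ‖∑ j ∈ range (2 * N), e (j * y b b' i)‖ ^ 2 ≤
        ∑ j ∈ range (N + 1), 4 * (N : ℝ) ^ 2 * (a j * (‖w i‖ * I j (y b b' i))) := by
    intro b _ b' _ i _
    have h := norm_sq_sum_e_le_dyadic hN (y b b' i)
    calc ‖w i‖ * ‖∑ j ∈ range (2 * N), e (j * y b b' i)‖ ^ 2
        ≤ ‖w i‖ * (4 * (N : ℝ) ^ 2 * ∑ j ∈ range (N + 1), (4 : ℝ)⁻¹ ^ j * I j (y b b' i)) :=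
          mul_le_mul_of_nonneg_left h (norm_nonneg _)
      _ = _ := by
          rw [ha, Finset.mul_sum, Finset.mul_sum]
          exact Finset.sum_congr rfl fun j _ => by ring
  refine (Finset.sum_le_sum fun b hb => Finset.sum_le_sum fun b' hb' =>
    Finset.sum_le_sum fun i hi => hterm b hb b' hb' i hi).trans (le_of_eq ?_)
  -- reorder the four sums
  calc ∑ b ∈ B, ∑ b' ∈ B, ∑ i ∈ T, ∑ j ∈ range (N + 1),
        4 * (N : ℝ) ^ 2 * (a j * (‖w i‖ * I j (y b b' i)))
      = ∑ b ∈ B, ∑ b' ∈ B, ∑ j ∈ range (N + 1), ∑ i ∈ T,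
          4 * (N : ℝ) ^ 2 * (a j * (‖w i‖ * I j (y b b' i))) :=
        Finset.sum_congr rfl fun _ _ => Finset.sum_congr rfl fun _ _ => Finset.sum_comm
    _ = ∑ b ∈ B, ∑ j ∈ range (N + 1), ∑ b' ∈ B, ∑ i ∈ T,
          4 * (N : ℝ) ^ 2 * (a j * (‖w i‖ * I j (y b b' i))) :=
        Finset.sum_congr rfl fun _ _ => Finset.sum_comm
    _ = ∑ j ∈ range (N + 1), ∑ b ∈ B, ∑ b' ∈ B, ∑ i ∈ T,
          4 * (N : ℝ) ^ 2 * (a j * (‖w i‖ * I j (y b b' i))) := Finset.sum_comm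
    _ = _ := by simp only [Finset.mul_sum, ha, hI, hy]

open Classical in
/-- The count at one dyadic scale, `V_j ≤ (2·2^j + 1)(1 + C_U) A |B|^{1+3ε}`: large denominators
by `sum_large_den_le` (`Q² ≤ N`), small ones by covering with `2^{j+1}+1` shifted windows of
width `1/N` and the small-denominator count. [cite: GreenTao2006Restriction, §4 (4.4)–(4.6)] -/
theorem dyadic_count_le {ι : Type*} (T : Finset ι) (θ : ι → ℝ) (q : ι → ℕ) (w : ι → ℂ)
    {Q : ℕ} {A ε CU : ℝ} (hA : 0 ≤ A) (hε : 0 < ε) (hε1 : ε ≤ 1)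
    (hq : ∀ i ∈ T, 1 ≤ q i ∧ q i ≤ Q) (hθ : ∀ i ∈ T, ∃ a : ℤ, θ i = a / q i)
    (hsep : ∀ i ∈ T, ∀ j ∈ T, i ≠ j → ∀ m : ℤ, θ i - θ j ≠ m)
    (hw : ∀ i ∈ T, ‖w i‖ ≤ A * (q i : ℝ) ^ (ε - 1))
    {N : ℕ} (hN : 0 < N) (hQN : Q ^ 2 ≤ N) (B : Finset ℕ) (hBne : B.Nonempty)
    (hU : ∀ l : ℤ, ∑ b ∈ B, ∑ b' ∈ B, ∑ i ∈ T.filter (fun i => (q i : ℝ) ≤ B.card),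
        ‖w i‖ * (if ∃ m : ℤ, |((b : ℝ) - b') / N + θ i - l / N - m| ≤ 1 / N then (1 : ℝ) else 0) ≤
        CU * A * (B.card : ℝ) ^ (1 + 3 * ε)) (j : ℕ) :
    ∑ b ∈ B, ∑ b' ∈ B, ∑ i ∈ T, ‖w i‖ *
        (if ∃ m : ℤ, |((b : ℝ) - b') / N + θ i - m| ≤ 2 ^ j / N then (1 : ℝ) else 0) ≤
      (2 * 2 ^ j + 1) * (1 + CU) * A * (B.card : ℝ) ^ (1 + 3 * ε) := by
  set κ : ℝ := (B.card : ℝ) with hκ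
  have hκ1 : 1 ≤ κ := by rw [hκ]; exact_mod_cast Finset.card_pos.2 hBne
  have hκ0 : 0 < κ := by linarith
  have hN0 : (0 : ℝ) < N := by exact_mod_cast hN
  set I : ℝ → ℝ := fun z => if ∃ m : ℤ, |z - m| ≤ 2 ^ j / N then (1 : ℝ) else 0 with hI
  -- split `T` by the size of the denominator
  have hsplitT : ∀ b ∈ B, ∀ b' ∈ B, ∑ i ∈ T, ‖w i‖ * I (((b : ℝ) - b') / N + θ i) =
      ∑ i ∈ T.filter (fun i => κ < q i), ‖w i‖ * I (((b : ℝ) - b') / N + θ i) +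
      ∑ i ∈ T.filter (fun i => (q i : ℝ) ≤ κ), ‖w i‖ * I (((b : ℝ) - b') / N + θ i) := by
    intro b _ b' _
    rw [← Finset.sum_filter_add_sum_filter_not T (fun i => κ < q i)]
    congr 1
    refine Finset.sum_congr (Finset.filter_congr fun i _ => not_lt) fun _ _ => rfl
  have hsplit : ∑ b ∈ B, ∑ b' ∈ B, ∑ i ∈ T, ‖w i‖ * I (((b : ℝ) - b') / N + θ i) =
      (∑ b ∈ B, ∑ b' ∈ B, ∑ i ∈ T.filter (fun i => κ < q i),
        ‖w i‖ * I (((b : ℝ) - b') / N + θ i)) +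
      ∑ b ∈ B, ∑ b' ∈ B, ∑ i ∈ T.filter (fun i => (q i : ℝ) ≤ κ),
        ‖w i‖ * I (((b : ℝ) - b') / N + θ i) := by
    rw [← Finset.sum_add_distrib]
    refine Finset.sum_congr rfl fun b hb => ?_
    rw [← Finset.sum_add_distrib]
    exact Finset.sum_congr rfl fun b' hb' => hsplitT b hb b' hb'
  rw [hsplit]
  -- large denominators
  have hlarge : ∑ b ∈ B, ∑ b' ∈ B, ∑ i ∈ T.filter (fun i => κ < q i),
      ‖w i‖ * I (((b : ℝ) - b') / N + θ i) ≤ (2 * 2 ^ j + 1) * A * κ ^ (1 + 3 * ε) := by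
    have h := sum_large_den_le T θ q w hA hε1 hq hθ hsep hw B hBne
      (fun b b' => ((b : ℝ) - b') / N) (r := 2 ^ j / N) (by positivity)
    refine h.trans ?_
    have hQ : 2 * ((2 : ℝ) ^ j / N) * (Q : ℝ) ^ 2 + 1 ≤ 2 * 2 ^ j + 1 := by
      have hQN' : ((Q : ℝ)) ^ 2 ≤ N := by exact_mod_cast hQN
      have : (2 : ℝ) ^ j / N * (Q : ℝ) ^ 2 ≤ 2 ^ j := by
        rw [div_mul_eq_mul_div, div_le_iff₀ hN0]
        exact mul_le_mul_of_nonneg_left hQN' (by positivity)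
      linarith
    have hexp : κ ^ (ε + 1) ≤ κ ^ (1 + 3 * ε) :=
      Real.rpow_le_rpow_of_exponent_le hκ1 (by linarith)
    calc A * κ ^ (ε + 1) * (2 * (2 ^ j / N) * (Q : ℝ) ^ 2 + 1)
        ≤ A * κ ^ (1 + 3 * ε) * (2 * 2 ^ j + 1) := by
          refine mul_le_mul (mul_le_mul_of_nonneg_left hexp hA) hQ (by positivity) ?_
          exact mul_nonneg hA (Real.rpow_nonneg hκ0.le _)
      _ = (2 * 2 ^ j + 1) * A * κ ^ (1 + 3 * ε) := by ring
  -- small denominators: cover by shifted windows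
  have hsmall : ∑ b ∈ B, ∑ b' ∈ B, ∑ i ∈ T.filter (fun i => (q i : ℝ) ≤ κ),
      ‖w i‖ * I (((b : ℝ) - b') / N + θ i) ≤ (2 * 2 ^ j + 1) * (CU * A * κ ^ (1 + 3 * ε)) := by
    set L : Finset ℤ := Finset.Icc (-(2 ^ j : ℤ)) (2 ^ j) with hL
    have hLcard : (L.card : ℝ) = 2 * 2 ^ j + 1 := by
      rw [hL, Int.card_Icc]
      have : ((2 : ℤ) ^ j + 1 - -2 ^ j).toNat = 2 * 2 ^ j + 1 := by
        have h0 : ((2 ^ j : ℕ) : ℤ) = (2 : ℤ) ^ j := by push_cast; rfl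
        omega
      rw [this]; push_cast; ring
    set I' : ℤ → ℝ → ℝ := fun l z =>
      if ∃ m : ℤ, |z - l / N - m| ≤ 1 / N then (1 : ℝ) else 0 with hI'
    have hcov : ∀ z : ℝ, I z ≤ ∑ l ∈ L, I' l z := fun z => indicator_near_le_sum_shift hN z j
    calc ∑ b ∈ B, ∑ b' ∈ B, ∑ i ∈ T.filter (fun i => (q i : ℝ) ≤ κ),
          ‖w i‖ * I (((b : ℝ) - b') / N + θ i)
        ≤ ∑ b ∈ B, ∑ b' ∈ B, ∑ i ∈ T.filter (fun i => (q i : ℝ) ≤ κ),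
            ∑ l ∈ L, ‖w i‖ * I' l (((b : ℝ) - b') / N + θ i) := by
          refine Finset.sum_le_sum fun b _ => Finset.sum_le_sum fun b' _ =>
            Finset.sum_le_sum fun i _ => ?_
          rw [← Finset.mul_sum]
          exact mul_le_mul_of_nonneg_left (hcov _) (norm_nonneg _)
      _ = ∑ l ∈ L, ∑ b ∈ B, ∑ b' ∈ B, ∑ i ∈ T.filter (fun i => (q i : ℝ) ≤ κ),
            ‖w i‖ * I' l (((b : ℝ) - b') / N + θ i) := by
          calc _ = ∑ b ∈ B, ∑ b' ∈ B, ∑ l ∈ L, ∑ i ∈ T.filter (fun i => (q i : ℝ) ≤ κ),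
                ‖w i‖ * I' l (((b : ℝ) - b') / N + θ i) :=
                Finset.sum_congr rfl fun _ _ => Finset.sum_congr rfl fun _ _ => Finset.sum_comm
            _ = ∑ b ∈ B, ∑ l ∈ L, ∑ b' ∈ B, ∑ i ∈ T.filter (fun i => (q i : ℝ) ≤ κ),
                ‖w i‖ * I' l (((b : ℝ) - b') / N + θ i) :=
                Finset.sum_congr rfl fun _ _ => Finset.sum_comm
            _ = _ := Finset.sum_comm
      _ ≤ ∑ l ∈ L, CU * A * κ ^ (1 + 3 * ε) := Finset.sum_le_sum fun l _ => hU l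
      _ = (2 * 2 ^ j + 1) * (CU * A * κ ^ (1 + 3 * ε)) := by
          rw [Finset.sum_const, nsmul_eq_mul, hLcard]
  calc _ ≤ (2 * 2 ^ j + 1) * A * κ ^ (1 + 3 * ε) + (2 * 2 ^ j + 1) * (CU * A * κ ^ (1 + 3 * ε)) :=
        add_le_add hlarge hsmall
    _ = (2 * 2 ^ j + 1) * (1 + CU) * A * κ ^ (1 + 3 * ε) := by ring

open Classical in
/-- **Case B of the set estimate** (`|B|² ≤ N`): the Fourier/Fejér argument gives
`∑_{n=1}^{N} |f̂(n)|² β₀(n) ≤ C(ε) A N |B|^{1+3ε}` for `f` supported on `B`, `|f| ≤ 1`.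
[cite: GreenTao2006Restriction, Prop. 4.1, proof of (4.2) for `|B| ≤ R^ε`] -/
theorem caseB_estimate {ε : ℝ} (hε : 0 < ε) (hε1 : ε ≤ 1) :
    ∃ C : ℝ, 0 < C ∧ ∀ {ι : Type*} (T : Finset ι) (θ : ι → ℝ) (q : ι → ℕ) (w : ι → ℂ)
      (A : ℝ) (Q : ℕ), 0 ≤ A → (∀ i ∈ T, 1 ≤ q i ∧ q i ≤ Q ∧ Squarefree (q i)) →
      (∀ i ∈ T, ∃ a : ℤ, θ i = a / q i) →
      (∀ i ∈ T, ∀ j ∈ T, i ≠ j → ∀ m : ℤ, θ i - θ j ≠ m) →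
      (∀ i ∈ T, ‖w i‖ ≤ A * (q i : ℝ) ^ (ε - 1)) →
      ∀ (β₀ : ℤ → ℝ), (∀ m : ℤ, (β₀ m : ℂ) = ∑ i ∈ T, w i * e (θ i * m)) → (∀ m, 0 ≤ β₀ m) →
      ∀ {N : ℕ}, 16 ≤ N → Q ^ 2 ≤ N → ∀ (B : Finset ℕ), B ⊆ range N → B.Nonempty →
      ((B.card : ℝ) ^ 2 ≤ N) → ∀ (f : ℕ → ℂ), (∀ b, ‖f b‖ ≤ 1) → (∀ b ∉ B, f b = 0) →
        ∑ n ∈ Icc 1 N, ‖∑ b ∈ range N, f b * e ((b : ℝ) * n / N)‖ ^ 2 * β₀ n ≤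
          C * A * N * (B.card : ℝ) ^ (1 + 3 * ε) := by
  obtain ⟨CU, hCU, hU⟩ := small_den_count_le hε
  refine ⟨24 * (1 + CU), by positivity, ?_⟩
  intro ι T θ q w A Q hA hq hθ hsep hw β₀ hβ₀ hβ₀nn N hN hQN B hB hBne hBN f hf hfB
  have hN0 : 0 < N := by omega
  have hN0r : (0 : ℝ) < N := by exact_mod_cast hN0
  set κ : ℝ := (B.card : ℝ) with hκ
  set G : ℤ → ℝ := fun m => ‖∑ b ∈ range N, f b * e ((b : ℝ) * m / N)‖ ^ 2 * β₀ m with hG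
  have hG0 : ∀ m, 0 ≤ G m := fun m => mul_nonneg (sq_nonneg _) (hβ₀nn m)
  -- (1) averaging
  have h1 : (N : ℝ) * ∑ n ∈ Icc 1 N, ‖∑ b ∈ range N, f b * e ((b : ℝ) * n / N)‖ ^ 2 * β₀ n ≤
      ∑ j₁ ∈ range (2 * N), ∑ j₂ ∈ range (2 * N), G ((N : ℤ) + j₁ - j₂) := by
    have := mul_sum_Icc_le_sum_sum (N := N) G hG0
    convert this using 3
    simp only [hG, Int.cast_natCast]
  -- (2) the Fejér double sum
  have h2 := fejer_double_sum_le hB hf hfB T θ w β₀ hβ₀ hβ₀nn (N := N)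
  -- (3) dyadic decomposition
  have h3 := sum_kernel_le_dyadic T θ w hN0 B
  -- (4) the counts at each scale
  have hq' : ∀ i ∈ T, 1 ≤ q i ∧ q i ≤ Q := fun i hi => ⟨(hq i hi).1, (hq i hi).2.1⟩
  have hq'' : ∀ i ∈ T, 1 ≤ q i ∧ Squarefree (q i) := fun i hi => ⟨(hq i hi).1, (hq i hi).2.2⟩
  have hUl := hU T θ q w A hA hq'' hθ hsep hw hN B hB hBne hBN
  have h4 : ∀ j : ℕ, ∑ b ∈ B, ∑ b' ∈ B, ∑ i ∈ T, ‖w i‖ *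
      (if ∃ m : ℤ, |((b : ℝ) - b') / N + θ i - m| ≤ 2 ^ j / N then (1 : ℝ) else 0) ≤
      (2 * 2 ^ j + 1) * (1 + CU) * A * κ ^ (1 + 3 * ε) := fun j =>
    dyadic_count_le T θ q w hA hε hε1 hq' hθ hsep hw hN0 hQN B hBne hUl j
  -- (5) combine
  have h5 : ∑ j ∈ range (N + 1), (4 : ℝ)⁻¹ ^ j *
      ∑ b ∈ B, ∑ b' ∈ B, ∑ i ∈ T, ‖w i‖ *
        (if ∃ m : ℤ, |((b : ℝ) - b') / N + θ i - m| ≤ 2 ^ j / N then (1 : ℝ) else 0) ≤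
      6 * ((1 + CU) * A * κ ^ (1 + 3 * ε)) := by
    calc _ ≤ ∑ j ∈ range (N + 1), (4 : ℝ)⁻¹ ^ j * ((2 * 2 ^ j + 1) * (1 + CU) * A * κ ^ (1 + 3 * ε)) :=
          Finset.sum_le_sum fun j _ => mul_le_mul_of_nonneg_left (h4 j) (by positivity)
      _ = (∑ j ∈ range (N + 1), (4 : ℝ)⁻¹ ^ j * (2 * 2 ^ j + 1)) *
            ((1 + CU) * A * κ ^ (1 + 3 * ε)) := by
          rw [Finset.sum_mul]; exact Finset.sum_congr rfl fun j _ => by ring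
      _ ≤ 6 * ((1 + CU) * A * κ ^ (1 + 3 * ε)) := by
          refine mul_le_mul_of_nonneg_right (sum_dyadic_weights_le N) ?_
          have : 0 ≤ κ ^ (1 + 3 * ε) := Real.rpow_nonneg (Nat.cast_nonneg _) _
          positivity
  have hchain : (N : ℝ) * ∑ n ∈ Icc 1 N, ‖∑ b ∈ range N, f b * e ((b : ℝ) * n / N)‖ ^ 2 * β₀ n ≤
      4 * (N : ℝ) ^ 2 * (6 * ((1 + CU) * A * κ ^ (1 + 3 * ε))) :=
    h1.trans (h2.trans (h3.trans (mul_le_mul_of_nonneg_left h5 (by positivity))))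
  refine le_of_mul_le_mul_left (hchain.trans (le_of_eq ?_)) hN0r
  ring


/-! ### Case A: `|B| ≥ M` — the moment bound -/

/-- Parseval over `[1, N]`: `∑_{n=1}^{N} |∑_{b<N} f(b) e(bn/N)|² ≤ N |B|` for `|f| ≤ 1` supported
on `B`. [folklore] -/
theorem sum_Icc_norm_sq_le {N : ℕ} (hN : 0 < N) {B : Finset ℕ} (hB : B ⊆ range N) {f : ℕ → ℂ}
    (hf : ∀ b, ‖f b‖ ≤ 1) (hfB : ∀ b ∉ B, f b = 0) :
    ∑ n ∈ Icc 1 N, ‖∑ b ∈ range N, f b * e ((b : ℝ) * n / N)‖ ^ 2 ≤ N * B.card := by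
  have hF : ∀ t : ℝ, ∑ b ∈ range N, f b * e ((b : ℝ) * t / N) = ∑ b ∈ B, f b * e ((b : ℝ) * t / N) :=
    fun t => (Finset.sum_subset hB fun b _ hb => by rw [hfB b hb, zero_mul]).symm
  have h := sum_window_norm_sq_le hN hB hf 1
  have hI : Icc 1 N = Ico 1 (N + 1) := by
    ext n; simp only [Finset.mem_Icc, Finset.mem_Ico]; omega
  rw [hI, Finset.sum_Ico_eq_sum_range, Nat.add_sub_cancel]
  refine le_trans (le_of_eq (Finset.sum_congr rfl fun j _ => ?_)) h
  rw [hF]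
  push_cast
  ring_nf

/-- **Case A of the set estimate** (`|B| ≥ M`): splitting `β ≤ κ^{2ε} + β^s κ^{-2ε(s-1)}`, Parseval
and the moment bound `∑_{n ≤ N} β(n)^s ≤ M N` give `∑_{n=1}^{N} |f̂(n)|² β(n) ≤ 2 N |B|^{1+2ε}`
(`εs ≥ 1`). [cite: GreenTao2006Restriction, Prop. 4.1, proof of (4.2) for `|B| ≥ R^ε`] -/
theorem caseA_estimate {ε Mm : ℝ} {s : ℕ} (hεs : 1 ≤ ε * s) (hs : 1 ≤ s) {N : ℕ}
    (hN : 0 < N) (β : ℤ → ℝ) (hβ0 : ∀ n ∈ Icc 1 N, 0 ≤ β n)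
    (hmom : ∑ n ∈ Icc 1 N, β n ^ s ≤ Mm * N) (B : Finset ℕ) (hB : B ⊆ range N)
    (hBM : Mm ≤ B.card) (hBne : B.Nonempty) (f : ℕ → ℂ) (hf : ∀ b, ‖f b‖ ≤ 1)
    (hfB : ∀ b ∉ B, f b = 0) :
    ∑ n ∈ Icc 1 N, ‖∑ b ∈ range N, f b * e ((b : ℝ) * n / N)‖ ^ 2 * β n ≤
      2 * N * (B.card : ℝ) ^ (1 + 2 * ε) := by
  set κ : ℝ := (B.card : ℝ) with hκ
  have hκ1 : 1 ≤ κ := by rw [hκ]; exact_mod_cast Finset.card_pos.2 hBne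
  have hκ0 : 0 < κ := by linarith
  have hN0 : (0 : ℝ) < N := by exact_mod_cast hN
  set Λ : ℝ := κ ^ (2 * ε) with hΛ
  have hΛ0 : 0 < Λ := Real.rpow_pos_of_pos hκ0 _
  set F : ℕ → ℝ := fun n => ‖∑ b ∈ range N, f b * e ((b : ℝ) * n / N)‖ ^ 2 with hF
  have hF0 : ∀ n, 0 ≤ F n := fun n => sq_nonneg _
  have hFκ : ∀ n, F n ≤ κ ^ 2 := by
    intro n
    have hsub : ∑ b ∈ range N, f b * e ((b : ℝ) * n / N) =
        ∑ b ∈ B, f b * e ((b : ℝ) * n / N) :=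
      (Finset.sum_subset hB fun b _ hb => by rw [hfB b hb, zero_mul]).symm
    rw [hF]; simp only; rw [hsub]
    exact pow_le_pow_left₀ (norm_nonneg _) (norm_sum_mul_e_le_card hf _) 2
  have hterm : ∀ n ∈ Icc 1 N, F n * β n ≤ Λ * F n + κ ^ 2 * β n ^ s / Λ ^ (s - 1) :=
    fun n hn => mul_le_split (hF0 n) (hFκ n) (hβ0 n hn) hΛ0 hs
  have hpars : ∑ n ∈ Icc 1 N, F n ≤ N * κ := by
    rw [hF, hκ]; exact sum_Icc_norm_sq_le hN hB hf hfB
  have hexp : κ ^ 2 * (Mm * N) / Λ ^ (s - 1) ≤ N * κ ^ (1 + 2 * ε) := by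
    have hs' : ((s - 1 : ℕ) : ℝ) = s - 1 := by rw [Nat.cast_sub hs, Nat.cast_one]
    have h1 : Λ ^ (s - 1) = κ ^ (2 * ε * (s - 1)) := by
      rw [hΛ, ← Real.rpow_natCast, ← Real.rpow_mul hκ0.le, hs']
    have h2 : κ ^ 2 * κ / Λ ^ (s - 1) = κ ^ (3 - 2 * ε * (s - 1)) := by
      rw [h1, Real.rpow_sub hκ0]
      congr 1
      rw [show (3 : ℝ) = ((3 : ℕ) : ℝ) by norm_num, Real.rpow_natCast]
      ring
    have h3 : κ ^ (3 - 2 * ε * (s - 1)) ≤ κ ^ (1 + 2 * ε) :=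
      Real.rpow_le_rpow_of_exponent_le hκ1 (by nlinarith)
    calc κ ^ 2 * (Mm * N) / Λ ^ (s - 1) ≤ κ ^ 2 * (κ * N) / Λ ^ (s - 1) := by
          gcongr
      _ = N * (κ ^ 2 * κ / Λ ^ (s - 1)) := by ring
      _ ≤ N * κ ^ (1 + 2 * ε) := by rw [h2]; exact mul_le_mul_of_nonneg_left h3 hN0.le
  have hΛκ : Λ * (N * κ) = N * κ ^ (1 + 2 * ε) := by
    rw [hΛ, show 1 + 2 * ε = 2 * ε + 1 by ring, Real.rpow_add_one hκ0.ne']; ring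
  calc ∑ n ∈ Icc 1 N, F n * β n
      ≤ ∑ n ∈ Icc 1 N, (Λ * F n + κ ^ 2 * β n ^ s / Λ ^ (s - 1)) := Finset.sum_le_sum hterm
    _ = Λ * ∑ n ∈ Icc 1 N, F n + κ ^ 2 * (∑ n ∈ Icc 1 N, β n ^ s) / Λ ^ (s - 1) := by
        rw [Finset.sum_add_distrib, Finset.mul_sum, Finset.mul_sum, Finset.sum_div]
    _ ≤ Λ * (N * κ) + κ ^ 2 * (Mm * N) / Λ ^ (s - 1) := by
        gcongr
    _ ≤ N * κ ^ (1 + 2 * ε) + N * κ ^ (1 + 2 * ε) := by rw [hΛκ]; exact add_le_add le_rfl hexp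
    _ = 2 * N * κ ^ (1 + 2 * ε) := by ring

/-! ### The set estimate -/

open Classical in
/-- **Green–Tao, Prop. 4.1, set version (4.2), abstract form.**  For `0 < ε ≤ 1/4` there is
`C = C(ε)` such that: for every finite family of frequencies `θ_i = a_i/q_i` (`1 ≤ q_i ≤ Q`
squarefree) pairwise distinct mod `1` with weights `|w_i| ≤ A q_i^{ε-1}` (`A ≥ 1`), every weight
`β₀(n) = ∑_i w_i e(θ_i n) ≥ 0` on `ℤ`, every `β` with `0 ≤ β ≤ β₀` on `[1, N]` and
`∑_{n ≤ N} β(n)^s ≤ M N` (`εs ≥ 1`, `1 ≤ M`, `M² ≤ N`, `Q² ≤ N`, `N ≥ 16`), and every `f`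
supported on `B ⊆ ℤ/Nℤ` with `|f| ≤ 1`,
`∑_{n=1}^{N} |∑_b f(b) e(bn/N)|² β(n) ≤ C A N |B|^{1+3ε}`.
[cite: GreenTao2006Restriction, Prop. 4.1 and (4.2)] -/
theorem restriction_set_estimate {ε : ℝ} (hε : 0 < ε) (hε1 : ε ≤ 1) :
    ∃ C : ℝ, 0 < C ∧ ∀ {ι : Type*} (T : Finset ι) (θ : ι → ℝ) (q : ι → ℕ) (w : ι → ℂ)
      (A : ℝ) (Q : ℕ), 1 ≤ A → (∀ i ∈ T, 1 ≤ q i ∧ q i ≤ Q ∧ Squarefree (q i)) →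
      (∀ i ∈ T, ∃ a : ℤ, θ i = a / q i) →
      (∀ i ∈ T, ∀ j ∈ T, i ≠ j → ∀ m : ℤ, θ i - θ j ≠ m) →
      (∀ i ∈ T, ‖w i‖ ≤ A * (q i : ℝ) ^ (ε - 1)) →
      ∀ (β₀ β : ℤ → ℝ), (∀ m : ℤ, (β₀ m : ℂ) = ∑ i ∈ T, w i * e (θ i * m)) → (∀ m, 0 ≤ β₀ m) →
      ∀ {N : ℕ} (s : ℕ) (Mm : ℝ), 16 ≤ N → Q ^ 2 ≤ N → 1 ≤ ε * s → 1 ≤ s → 1 ≤ Mm →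
      Mm ^ 2 ≤ N → (∀ n ∈ Icc 1 N, 0 ≤ β n ∧ β n ≤ β₀ n) → (∑ n ∈ Icc 1 N, β n ^ s ≤ Mm * N) →
      ∀ (B : Finset ℕ) (f : ℕ → ℂ), B ⊆ range N → (∀ b, ‖f b‖ ≤ 1) → (∀ b ∉ B, f b = 0) →
        ∑ n ∈ Icc 1 N, ‖∑ b ∈ range N, f b * e ((b : ℝ) * n / N)‖ ^ 2 * β n ≤
          C * A * N * (B.card : ℝ) ^ (1 + 3 * ε) := by
  obtain ⟨CB, hCB, hB'⟩ := caseB_estimate hε hε1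
  refine ⟨max 2 CB, by positivity, ?_⟩
  intro ι T θ q w A Q hA hq hθ hsep hw β₀ β hβ₀ hβ₀nn N s Mm hN hQN hεs hs hMm hMmN hβ hmom B f hB
    hf hfB
  have hN0 : 0 < N := by omega
  have hN0r : (0 : ℝ) < N := by exact_mod_cast hN0
  rcases B.eq_empty_or_nonempty with hBe | hBne
  · -- `f = 0`
    have hf0 : ∀ b, f b = 0 := fun b => hfB b (by rw [hBe]; exact Finset.notMem_empty b)
    simp only [hf0, zero_mul, Finset.sum_const_zero, norm_zero]
    rw [zero_pow two_ne_zero]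
    simp only [zero_mul, Finset.sum_const_zero]
    have : 0 ≤ (B.card : ℝ) ^ (1 + 3 * ε) := Real.rpow_nonneg (Nat.cast_nonneg _) _
    positivity
  set κ : ℝ := (B.card : ℝ) with hκ
  have hκ1 : 1 ≤ κ := by rw [hκ]; exact_mod_cast Finset.card_pos.2 hBne
  have hκ0 : 0 < κ := by linarith
  have hpow : 0 ≤ κ ^ (1 + 3 * ε) := Real.rpow_nonneg hκ0.le _
  rcases le_or_gt Mm κ with hcase | hcase
  · -- Case A
    have hA' := caseA_estimate hεs hs hN0 β (fun n hn => (hβ n hn).1) hmom B hB hcase hBne f hf hfB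
    refine hA'.trans ?_
    have h1 : κ ^ (1 + 2 * ε) ≤ κ ^ (1 + 3 * ε) :=
      Real.rpow_le_rpow_of_exponent_le hκ1 (by linarith)
    have h2 : (2 : ℝ) ≤ max 2 CB := le_max_left _ _
    calc 2 * (N : ℝ) * κ ^ (1 + 2 * ε) ≤ 2 * N * κ ^ (1 + 3 * ε) := by gcongr
      _ = 2 * 1 * N * κ ^ (1 + 3 * ε) := by ring
      _ ≤ max 2 CB * A * N * κ ^ (1 + 3 * ε) := by gcongr
  · -- Case B, applied to `β₀`
    have hκN : κ ^ 2 ≤ N := by nlinarith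
    have hB0 := hB' T θ q w A Q (by linarith) hq hθ hsep hw β₀ hβ₀ hβ₀nn hN hQN B hB hBne hκN f hf hfB
    calc ∑ n ∈ Icc 1 N, ‖∑ b ∈ range N, f b * e ((b : ℝ) * n / N)‖ ^ 2 * β n
        ≤ ∑ n ∈ Icc 1 N, ‖∑ b ∈ range N, f b * e ((b : ℝ) * n / N)‖ ^ 2 * β₀ n :=
          Finset.sum_le_sum fun n hn => mul_le_mul_of_nonneg_left (hβ n hn).2 (sq_nonneg _)
      _ ≤ CB * A * N * κ ^ (1 + 3 * ε) := hB0
      _ ≤ max 2 CB * A * N * κ ^ (1 + 3 * ε) := by gcongr; exact le_max_right _ _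

end GreenTao2006

end Literature.NumberTheory.Sieve
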